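import Literature.Topology.FourManifolds.LefschetzBasePages
import Literature.Topology.FourManifolds.RegularDomainMaps
import Literature.Topology.FourManifolds.RotationBody
import Literature.Topology.FourManifolds.ClosedBall
import Literature.Geometry.Symplectic.PlanarContactBoundary
import Literature.Geometry.Manifold.OpenEmbeddingCriterion
import Mathlib.Geometry.Manifold.Instances.Sphere
import Mathlib.Analysis.SpecialFunctions.Complex.Analytic
import Mathlib.Analysis.SpecialFunctions.Trigonometric.Bounds
import HarnessLib

/-!
# The standard Lefschetz base of genus `g`, IV: the boundary open book of `∂ Base g`

Topic `Literature/Topology/FourManifolds`; namespace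
`Literature.Topology.FourManifolds.LefschetzBase`.
Fourth vocabulary file of the concrete base `Base g = {rho g ≤ 1/4} ⊂ ℂ²`
(`LefschetzBaseModel.lean`, `LefschetzBaseRegular.lean`, `LefschetzBasePages.lean`:
`rho = ‖w‖² + eta ‖x‖²`, `w = y² − x^{2g+1} − 1`, `eta ≡ 0` on `‖x‖² ≤ 4`, `eta = exp(−1/(s−4))`
beyond).  A CONSTRUCTION with proved properties; NOTHING is asserted.  It inhabits the tree's
open-book interface `Literature.Geometry.Symplectic.OpenBook` (`PlanarContactBoundary.lean`:
binding tubes in normal form, a fibration `π : M ∖ B → 𝕊¹` which is a submersion) for the boundary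
3-manifold `∂ Base g` — the carrier `(bBase g).carrier` of the boundary datum of the base, i.e.
the level `{rho g = 1/4}` with the smooth structure of `RegularLevelSplitting.lean` /
`Cobordism.lean` — so that statements about Stein fillings and supported contact structures of
Lefschetz fibrations over the disc (Etnyre–Fuller 2006, §2; Baykur 2006, p. 13–14: the boundary
open book of `X(F; γ₁, …, γₙ)`, with page `F` and monodromy the product of the twists) can be
made over this vocabulary, starting with the trivial one: on paper
`∂ Base g = ∂(F_{g,1} × D²) = F_{g,1} × S¹ ∪ ∂F_{g,1} × D²`, the open book with page `F_{g,1}`,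
binding `∂F_{g,1}` (ONE circle) and trivial monodromy (Etnyre 2006, §2; Gompf–Stipsicz 1999, §8.2).

## The geometry (all of it checked below)

* **The binding** `B = {w = 0} ∩ ∂ Base g`.  On `∂ Base g`, `w = 0` forces `eta ‖x‖² = 1/4`,
  i.e. `‖x‖² = s₀ := etaInv (1/4)` (`etaInv t = 4 − 1/log t` inverts the cut-off on `(0, 1)`,
  §10), so `B = {y² = x^{2g+1} + 1, ‖x‖ = r₀}`: the part of the central page over the circle
  `‖x‖ = r₀ > 2` — a connected double cover of that circle (`x^{2g+1} + 1` winds an odd number of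
  times), i.e. the boundary circle of `F_{g,1}`.  It is parametrised ONCE by `P ∈ 𝕊¹ ⊂ ℂ`:
  `x = r₀ P²`, `y = P^{2g+1} √Q₀ √(1 + P̄^{4g+2}/Q₀)` (`Q₀ = r₀^{2g+1} > 2`, principal square root
  of a number of real part `> 3/8`; `P ↦ −P` exchanges the two sheets `±y`).
* **The tube** (§11–§13) `tube g : 𝕊¹ × ℝ² → ∂ Base g`, `(P, v) ↦ (x, y)` with
  `w = w̃(v) := v/(4√(1 + ‖v‖²))` (a positive multiple of `v`, of modulus `< 1/4`), `x = r(v) P²`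
  on the circle of squared radius `S(v) = etaInv (1/4 − ‖w̃ v‖²)` dictated by the level equation,
  and `y = P^{2g+1} √Q(v) √(1 + (1 + w̃) P̄^{4g+2}/Q(v))` the smooth square root of
  `x^{2g+1} + 1 + w̃` (`Q = r^{2g+1}`).  Then `w ∘ tube = w̃` (the NORMAL FORM
  `π (tube (P, v)) = v/‖v‖`), `rho ∘ tube = 1/4`, the tube is injective, its image is the open
  solid torus `{‖w‖ < 1/4}` (every such boundary point is reached: `w` gives `v`, the level
  equation gives `‖x‖`, a square root of `x/r` gives `±P`), and it has the explicit inverse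
  `y ↦ (P(x, y)/‖P‖, u(w))` with `P(x, y) = y x̄^g/(‖x‖^g √(‖x‖^{2g+1}) √(y²/x^{2g+1}))` and
  `u(w) = 4w/√(1 − 16‖w‖²)`, smooth on the image; by the tree's embedding criterion
  (`Literature.Geometry.Manifold.isSmoothEmbedding_of_leftInverse_of_isOpenMap`, Lee 2013,
  Prop. 5.2) it is a smooth embedding with open range.  Maps INTO `∂ Base g` are smooth by Lee's
  Cor. 5.30 twice (`bPt`, `contMDiffAt_bPt`, §8: `HalfSliceAtlas.contMDiffAt_codRestrict` into the
  regular domain, then `BoundaryManifold.contMDiffAt_codRestrict` into its boundary).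
* **The fibration** (§14) `π = proj g = w/‖w‖ : ∂ Base g → 𝕊¹` (junk on `B`), smooth off `B`;
  on the flat part `‖x‖² < 4` of the boundary `‖w‖ = 1/2` and the fibre of `π` over `c` is the
  base page `page g c = {w = c/2}` (§16, both inclusions); the positive normal direction of the
  pages is increasing `arg w`, as fixed in `LefschetzBasePages.lean`, Conventions (b).
* **Submersion** (§15): at `y₀ ∉ B` there is a curve in `∂ Base g` along which
  `w = e^{ic(t)} w₀` with `c'(0) ≠ 0`, so `dθ ≠ 0` by the chain rule: for `y₀ ≠ 0` keep `x` and
  take `y(t) = y₀ √(1 + (e^{it} − 1) w₀/y₀²)` (curve A: `w = e^{it} w₀`, `rho` constant); for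
  `y₀ = 0` (then `‖x₀‖ < 2`) keep `y = 0` and take
  `x(t) = x₀ (e^{ic} + (e^{ic} − 1)/x₀^{2g+1})^{1/(2g+1)}`
  with the squashed parameter `c(t) = δ t/√(1 + t²)`, `δ = 2^{2g+1} − ‖x₀‖^{2g+1}`, which keeps
  `‖x(t)‖ ≤ 2` for all times (curve B).

## Main definitions and results

* `LefschetzBase.bPt`, `inclB`, `contMDiffAt_bPt`, `contMDiff_inclB` (§8); `vec2 : ℂ → ℝ²`,
  `contDiffAt_csqrt`, `csqrt_re_pos` (§9); `etaInv`, `eta_etaInv`, `etaInv_eta`, `wsc`, `wTil`,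
  `radS`, `rad`, `radQ` (§10); `tubeAmb`, `w_tubeAmb`, `rho_tubeAmb`, `contDiffAt_tubeAmb` (§11);
* `LefschetzBase.tube`, `contMDiff_tube`, `w_tube`, `tube_injective`, `range_tube`
  (`= {‖w‖ < 1/4}`), `tubeInv`, `contMDiffOn_tubeInv`, **`isSmoothEmbedding_tube`** (§12–§13);
* `tubesBinding_tube` (`B = {w = 0}`), `LefschetzBase.proj`, `proj_tube`, `contMDiffOn_proj` (§14);
  `angularDeriv_proj_ne_zero_of_curve`, `curveA`, `curveB`, **`angularDeriv_proj_ne_zero`** (§15);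
* **`LefschetzBase.boundaryOpenBook g : OpenBook (bBase g).carrier`**, `binding_boundaryOpenBook`,
  `mem_binding_boundaryOpenBook_iff`, `proj_boundaryOpenBook`, `range_boundaryOpenBook_tube`,
  `mem_page_boundaryOpenBook_of_mem_page`, `mem_page_of_mem_page_boundaryOpenBook` (§16).

## What is NOT here

No contact or Stein structure: that `∂ Base g` with the complex tangencies of SOME Stein
structure on `Base g` is supported by this open book (Torisu 2000 / Giroux 2002 for the trivial
open book of `#^{2g} S¹ × S²`) is a separate fact over this vocabulary (the flat complex structure
of `ℂ² ⊃ Base g` does not serve: `{‖w‖ = 1/2}` is Levi-flat); no identification of the pages off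
the flat part with `F_{g,1}`, no monodromy.

## References
* J. B. Etnyre, T. Fuller, *Realizing 4-manifolds as achiral Lefschetz fibrations*, IMRN 2006,
  §2. [EtnyreFuller2006]
* J. B. Etnyre, *Lectures on open book decompositions and contact structures*, Clay Math. Proc.
  5 (2006), §2 (Def. 2.1 and the Example `∂(F × D²)`). [Etnyre2006]
* R. E. Gompf, A. I. Stipsicz, *4-Manifolds and Kirby Calculus*, GSM 20 (1999), §8.2.
* R. İ. Baykur, *Kähler decomposition of 4-manifolds*, AGT 6 (2006), pp. 13–14. [Baykur2006]
* C. Wendl, *Lectures on Contact 3-Manifolds, Holomorphic Curves and Intersection Theory* (2020),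
  §5.1, p. 77 (normal form of an open book near the binding). [Wendl2020]
* J. M. Lee, *Introduction to Smooth Manifolds*, 2nd ed., GTM 218 (2013), Prop. 5.2, Cor. 5.30.
  [LeeSmoothManifolds2013]
-/

noncomputable section

open scoped Manifold ContDiff Topology ComplexConjugate
open Set Function Metric Complex

namespace Literature.Topology.FourManifolds

/-- Local notation: `𝔼 n` is the model Euclidean space `EuclideanSpace ℝ (Fin n)`. -/
local notation "𝔼 " n:arg => EuclideanSpace ℝ (Fin n)
/-- Local notation: the unit circle in `ℝ²`. -/
local notation "𝕊¹" => (Metric.sphere (0 : EuclideanSpace ℝ (Fin 2)) 1)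

attribute [local instance] fact_finrank_euclideanSpace_succ

namespace LefschetzBase

/-! ## §8 The boundary `∂ Base g` as a 3-manifold: points and smooth maps -/

/-- The point of the boundary 3-manifold `∂ Base g = {rho g = 1/4}` (the carrier of the boundary
datum `bBase g`) given by an ambient point on the level. [folklore] -/
def bPt (g : ℕ) (p : 𝔼 4) (hp : rho g p = 1 / 4) : (bBase g).carrier :=
  (⟨RegularSublevel.mk (isRegularLevel_rho g) p hp.le,
    (RegularSublevel.mem_boundary_iff (isRegularLevel_rho g) _).2 hp⟩ :
      ↥((𝓡∂ 4).boundary (Base g)))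

/-- The ambient point of `ℝ⁴ = ℂ²` underlying a point of `∂ Base g`. [folklore] -/
def inclB (g : ℕ) (y : (bBase g).carrier) : 𝔼 4 := ((bBase g).incl y).1

/-- `inclB ∘ bPt = id` on ambient points (definitional). [folklore] -/
@[simp] theorem inclB_bPt (g : ℕ) (p : 𝔼 4) (hp : rho g p = 1 / 4) : inclB g (bPt g p hp) = p := rfl

/-- Points of `∂ Base g` lie on the level `rho g = 1/4`. [folklore] -/
theorem rho_inclB (g : ℕ) (y : (bBase g).carrier) : rho g (inclB g y) = 1 / 4 :=
  RegularSublevel.apply_incl_boundary (isRegularLevel_rho g) y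

/-- `inclB` is injective (two subtype inclusions). [folklore] -/
theorem inclB_injective (g : ℕ) : Injective (inclB g) := fun _ _ h =>
  Subtype.ext (Subtype.ext h)

/-- `bPt ∘ inclB = id`. [folklore] -/
@[simp] theorem bPt_inclB (g : ℕ) (y : (bBase g).carrier) :
    bPt g (inclB g y) (rho_inclB g y) = y :=
  inclB_injective g rfl

/-- **`inclB : ∂ Base g → ℝ⁴` is smooth** (the boundary inclusion followed by the inclusion of
the regular domain `Base g ⊂ ℝ⁴`). [folklore] -/
theorem contMDiff_inclB (g : ℕ) : ContMDiff (𝓡 3) (𝓡 4) ∞ (inclB g) :=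
  (RegularSublevel.contMDiff_incl (isRegularLevel_rho g)).comp (bBase g).isSmoothEmbedding.contMDiff

/-- `inclB` is continuous. [folklore] -/
theorem continuous_inclB (g : ℕ) : Continuous (inclB g) := (contMDiff_inclB g).continuous

/-- **Smooth maps into `∂ Base g`** (Lee 2013, Cor. 5.30, twice: into the regular domain
`Base g`, `HalfSliceAtlas.contMDiffAt_codRestrict`, then into its boundary,
`BoundaryManifold.contMDiffAt_codRestrict`): a map into `ℝ⁴` with values on the level
`rho g = 1/4` which is smooth at a point is smooth there as a map into `∂ Base g`.
[cite: LeeSmoothManifolds2013, Cor. 5.30] -/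
theorem contMDiffAt_bPt {E' H' : Type*} [NormedAddCommGroup E'] [NormedSpace ℝ E']
    [TopologicalSpace H'] {J : ModelWithCorners ℝ E' H'} {N : Type*} [TopologicalSpace N]
    [ChartedSpace H' N] (g : ℕ) {F : N → 𝔼 4} (hF : ∀ n, rho g (F n) = 1 / 4) {n : N}
    (hFs : ContMDiffAt J (𝓡 4) ∞ F n) :
    ContMDiffAt J (𝓡 3) ∞ (fun n => bPt g (F n) (hF n)) n := by
  -- adapted from `RegularSublevel.contMDiff_levelFoot`
  -- (Literature/Topology/FourManifolds/LevelFeetSymmetry.lean)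
  have h1 : ContMDiffAt J (𝓡∂ 4) ∞
      (fun n => (RegularSublevel.mk (isRegularLevel_rho g) (F n) (hF n).le : Base g)) n :=
    (RegularSublevel.halfSliceAtlas (isRegularLevel_rho g)).contMDiffAt_codRestrict
      (fun n => (hF n).le) hFs
  exact BoundaryManifold.contMDiffAt_codRestrict (W := Base g)
    (g := fun n => (RegularSublevel.mk (isRegularLevel_rho g) (F n) (hF n).le : Base g))
    (fun n => (bPt g (F n) (hF n)).2) h1

/-- Smooth maps into `∂ Base g`, global form. [cite: LeeSmoothManifolds2013, Cor. 5.30] -/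
theorem contMDiff_bPt {E' H' : Type*} [NormedAddCommGroup E'] [NormedSpace ℝ E']
    [TopologicalSpace H'] {J : ModelWithCorners ℝ E' H'} {N : Type*} [TopologicalSpace N]
    [ChartedSpace H' N] (g : ℕ) {F : N → 𝔼 4} (hF : ∀ n, rho g (F n) = 1 / 4)
    (hFs : ContMDiff J (𝓡 4) ∞ F) :
    ContMDiff J (𝓡 3) ∞ (fun n => bPt g (F n) (hF n)) :=
  fun n => contMDiffAt_bPt g hF (hFs n)

/-! ## §9 Plane vectors of complex numbers; the smooth square root -/

/-- The vector `(Re z, Im z) ∈ ℝ²` of a complex number (inverse of `toC`). [folklore] -/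
def vec2 (z : ℂ) : 𝔼 2 := WithLp.toLp 2 ![z.re, z.im]

/-- `(vec2 z)₀ = Re z`. [folklore] -/
@[simp] theorem vec2_apply_zero (z : ℂ) : vec2 z 0 = z.re := rfl

/-- `(vec2 z)₁ = Im z`. [folklore] -/
@[simp] theorem vec2_apply_one (z : ℂ) : vec2 z 1 = z.im := rfl

/-- `toC ∘ vec2 = id`. [folklore] -/
@[simp] theorem toC_vec2 (z : ℂ) : toC (vec2 z) = z := Complex.ext rfl rfl

/-- `vec2 ∘ toC = id`. [folklore] -/
@[simp] theorem vec2_toC (v : 𝔼 2) : vec2 (toC v) = v := by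
  ext i; fin_cases i <;> rfl

/-- `vec2` is injective. [folklore] -/
theorem vec2_injective : Injective vec2 := fun z z' h => by
  rw [← toC_vec2 z, h, toC_vec2]

/-- `vec2` preserves the norm. [folklore] -/
@[simp] theorem norm_vec2 (z : ℂ) : ‖vec2 z‖ = ‖z‖ := by
  rw [← norm_toC (vec2 z), toC_vec2]

/-- `vec2 z = 0 ↔ z = 0`. [folklore] -/
@[simp] theorem vec2_eq_zero_iff (z : ℂ) : vec2 z = 0 ↔ z = 0 := by
  rw [← norm_eq_zero, norm_vec2, norm_eq_zero]

/-- `vec2` as a real continuous linear map. [folklore] -/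
def vec2L : ℂ →L[ℝ] 𝔼 2 :=
  LinearMap.toContinuousLinearMap
    { toFun := vec2
      map_add' := fun z z' => by ext i; fin_cases i <;> simp [vec2]
      map_smul' := fun c z => by ext i; fin_cases i <;> simp [vec2] }

/-- `vec2L` is `vec2`. [folklore] -/
@[simp] theorem vec2L_apply (z : ℂ) : vec2L z = vec2 z := rfl

/-- `vec2` is smooth (real linear). [folklore] -/
theorem contDiff_vec2 : ContDiff ℝ ∞ vec2 := vec2L.contDiff

/-- `vec2` is additive. [folklore] -/
theorem vec2_add (z z' : ℂ) : vec2 (z + z') = vec2 z + vec2 z' := map_add vec2L z z'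

/-- `vec2` commutes with real scalars. [folklore] -/
theorem vec2_smul (c : ℝ) (z : ℂ) : vec2 (c • z) = c • vec2 z := map_smul vec2L c z

/-- `vec2 (c z) = c • vec2 z` for real `c`. [folklore] -/
theorem vec2_ofReal_mul (c : ℝ) (z : ℂ) : vec2 ((c : ℂ) * z) = c • vec2 z := by
  rw [← vec2_smul, Complex.real_smul]

/-- A unit complex number gives a point of the unit circle `𝕊¹ ⊂ ℝ²`. [folklore] -/
theorem vec2_mem_sphere {z : ℂ} (hz : ‖z‖ = 1) : vec2 z ∈ 𝕊¹ := by
  rw [mem_sphere_zero_iff_norm, norm_vec2, hz]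

/-- **The principal square root is smooth on the slit plane** (it is complex analytic there).
[folklore] -/
theorem contDiffAt_csqrt {z : ℂ} (hz : z ∈ slitPlane) : ContDiffAt ℝ ∞ csqrt z := by
  have h : AnalyticAt ℂ (fun u : ℂ => u ^ ((2 : ℂ)⁻¹)) z := analyticAt_id.cpow analyticAt_const hz
  exact h.restrictScalars.contDiffAt

/-- The principal square root of a number of positive real part has positive real part
(`arg √z = (arg z)/2 ∈ (-π/4, π/4)`). [folklore] -/
theorem csqrt_re_pos {z : ℂ} (hz : 0 < z.re) : 0 < (csqrt z).re := by
  have hz0 : z ≠ 0 := fun h => by rw [h, Complex.zero_re] at hz; exact lt_irrefl _ hz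
  rw [csqrt, Complex.cpow_def_of_ne_zero hz0, Complex.exp_re]
  refine mul_pos (Real.exp_pos _) (Real.cos_pos_of_mem_Ioo ⟨?_, ?_⟩)
  · have h1 : (Complex.log z * (2 : ℂ)⁻¹).im = Complex.arg z / 2 := by
      simp [Complex.log_im]; ring
    rw [h1]
    have := Complex.neg_pi_lt_arg z
    have h2 : |Complex.arg z| < Real.pi / 2 := Complex.abs_arg_lt_pi_div_two_iff.2 (Or.inl hz)
    have h3 := (abs_lt.1 h2).1
    linarith [Real.pi_pos]
  · have h1 : (Complex.log z * (2 : ℂ)⁻¹).im = Complex.arg z / 2 := by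
      simp [Complex.log_im]; ring
    rw [h1]
    have h2 : |Complex.arg z| < Real.pi / 2 := Complex.abs_arg_lt_pi_div_two_iff.2 (Or.inl hz)
    have h3 := (abs_lt.1 h2).2
    linarith [Real.pi_pos]

/-- `‖√z‖² = ‖z‖`. [folklore] -/
theorem norm_csqrt_sq (z : ℂ) : ‖csqrt z‖ ^ 2 = ‖z‖ := by
  rw [← norm_pow, csqrt_sq]

-- `csqrt_ne_zero_of_ne_zero`, `csqrt_one_eq_one` duplicate `csqrt_ne_zero`, `csqrt_one` of
-- `LefschetzBaseCover.lean` (not imported here: it depends on the homology of the Milnor fibre).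
/-- `√z ≠ 0` for `z ≠ 0`. [folklore] -/
theorem csqrt_ne_zero_of_ne_zero {z : ℂ} (hz : z ≠ 0) : csqrt z ≠ 0 := fun h => by
  have := csqrt_sq z; rw [h, zero_pow two_ne_zero] at this; exact hz this.symm

/-- `√1 = 1`. [folklore] -/
theorem csqrt_one_eq_one : csqrt 1 = 1 := by simp [csqrt]

/-- `(a, b) ↦ mk a b : ℂ × ℂ → ℝ⁴` is smooth (real linear). [folklore] -/
theorem contDiff_mk_uncurry : ContDiff ℝ ∞ fun z : ℂ × ℂ => mk z.1 z.2 := by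
  rw [contDiff_euclidean]
  intro i
  fin_cases i
  · exact (Complex.reCLM.contDiff.comp contDiff_fst)
  · exact (Complex.imCLM.contDiff.comp contDiff_fst)
  · exact (Complex.reCLM.contDiff.comp contDiff_snd)
  · exact (Complex.imCLM.contDiff.comp contDiff_snd)

/-- `mk` of two smooth functions is smooth at a point. [folklore] -/
theorem contDiffAt_mk {X : Type*} [NormedAddCommGroup X] [NormedSpace ℝ X] {a b : X → ℂ}
    {x : X} (ha : ContDiffAt ℝ ∞ a x) (hb : ContDiffAt ℝ ∞ b x) :
    ContDiffAt ℝ ∞ (fun x => mk (a x) (b x)) x :=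
  contDiff_mk_uncurry.contDiffAt.comp x (ha.prodMk hb)

/-! ## §10 The inverse cut-off and the radii of the level tori around the binding -/

/-- **The inverse of the cut-off on `(0, 1)`**: `etaInv t = 4 − 1/log t`, so that
`eta (etaInv t) = exp (log t) = t`. [folklore] -/
def etaInv (t : ℝ) : ℝ := 4 - (Real.log t)⁻¹

/-- `etaInv t > 4` for `t ∈ (0, 1)` (`log t < 0`). [folklore] -/
theorem four_lt_etaInv {t : ℝ} (h0 : 0 < t) (h1 : t < 1) : 4 < etaInv t := by
  have hlog : Real.log t < 0 := Real.log_neg h0 h1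
  have : (Real.log t)⁻¹ < 0 := inv_lt_zero.2 hlog
  unfold etaInv; linarith

/-- **`eta ∘ etaInv = id` on `(0, 1)`.** [folklore] -/
theorem eta_etaInv {t : ℝ} (h0 : 0 < t) (h1 : t < 1) : eta (etaInv t) = t := by
  rw [eta_eq_exp (four_lt_etaInv h0 h1)]
  have : -(etaInv t - 4)⁻¹ = Real.log t := by
    unfold etaInv; rw [sub_sub_cancel_left, inv_neg, neg_neg, inv_inv]
  rw [this, Real.exp_log h0]

/-- **`etaInv ∘ eta = id` beyond the flat region**: a level `eta s = t` with `s > 4` is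
`s = etaInv t`. [folklore] -/
theorem etaInv_eta {s : ℝ} (hs : 4 < s) : etaInv (eta s) = s := by
  rw [eta_eq_exp hs, etaInv, Real.log_exp, inv_neg, inv_inv]
  ring

/-- `etaInv` is smooth on `(0, 1)`. [folklore] -/
theorem contDiffAt_etaInv {t : ℝ} (h0 : 0 < t) (h1 : t < 1) : ContDiffAt ℝ ∞ etaInv t :=
  contDiffAt_const.sub ((Real.contDiffAt_log.2 h0.ne').inv (Real.log_neg h0 h1).ne)

/-- The radial rescaling `s(v) = 1/(4√(1 + ‖v‖²))` of the meridional disc coordinate.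
[folklore] -/
def wsc (v : 𝔼 2) : ℝ := (4 * √(1 + ‖v‖ ^ 2))⁻¹

/-- `s(v) > 0`. [folklore] -/
theorem wsc_pos (v : 𝔼 2) : 0 < wsc v :=
  inv_pos.2 (mul_pos (by norm_num) (Real.sqrt_pos.2 (by positivity : (0 : ℝ) < 1 + ‖v‖ ^ 2)))

/-- `s(v) ‖v‖ < 1/4` (`‖v‖ < √(1 + ‖v‖²)`). [folklore] -/
theorem wsc_mul_norm_lt (v : 𝔼 2) : wsc v * ‖v‖ < 1 / 4 := by
  have h1 : ‖v‖ < √(1 + ‖v‖ ^ 2) := (Real.lt_sqrt (norm_nonneg v)).2 (by linarith)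
  have h2 : 0 < √(1 + ‖v‖ ^ 2) := Real.sqrt_pos.2 (by positivity : (0 : ℝ) < 1 + ‖v‖ ^ 2)
  rw [wsc, inv_mul_eq_div, div_lt_div_iff₀ (by positivity) (by norm_num : (0:ℝ) < 4)]
  linarith

/-- `s` is smooth. [folklore] -/
theorem contDiff_wsc : ContDiff ℝ ∞ wsc := by
  have h1 : ContDiff ℝ ∞ fun v : 𝔼 2 => 1 + ‖v‖ ^ 2 := contDiff_const.add (contDiff_norm_sq ℝ)
  have h2 : ContDiff ℝ ∞ fun v : 𝔼 2 => √(1 + ‖v‖ ^ 2) :=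
    h1.sqrt fun v => (by positivity : (0 : ℝ) < 1 + ‖v‖ ^ 2).ne'
  exact (contDiff_const.mul h2).inv fun v =>
    (mul_pos (by norm_num : (0:ℝ) < 4)
      (Real.sqrt_pos.2 (by positivity : (0 : ℝ) < 1 + ‖v‖ ^ 2))).ne'

/-- **The `w`-value of the tube**: `w̃(v) = s(v) · v ∈ ℂ`, of modulus `< 1/4`, pointing in the
direction of `v`. [folklore] -/
def wTil (v : 𝔼 2) : ℂ := (wsc v : ℂ) * toC v

/-- `‖w̃(v)‖ = s(v) ‖v‖`. [folklore] -/
theorem norm_wTil (v : 𝔼 2) : ‖wTil v‖ = wsc v * ‖v‖ := by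
  rw [wTil, norm_mul, Complex.norm_real, Real.norm_eq_abs, abs_of_pos (wsc_pos v), norm_toC]

/-- `‖w̃(v)‖ < 1/4`. [folklore] -/
theorem norm_wTil_lt (v : 𝔼 2) : ‖wTil v‖ < 1 / 4 := by
  rw [norm_wTil]; exact wsc_mul_norm_lt v

/-- `‖w̃(v)‖² < 1/16`. [folklore] -/
theorem norm_wTil_sq_lt (v : 𝔼 2) : ‖wTil v‖ ^ 2 < 1 / 16 := by
  have h := norm_wTil_lt v
  have h0 := norm_nonneg (wTil v)
  nlinarith

/-- `vec2 (w̃ v) = s(v) • v`. [folklore] -/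
theorem vec2_wTil (v : 𝔼 2) : vec2 (wTil v) = wsc v • v := by
  rw [wTil, vec2_ofReal_mul, vec2_toC]

/-- `w̃ v = 0 ↔ v = 0`. [folklore] -/
theorem wTil_eq_zero_iff (v : 𝔼 2) : wTil v = 0 ↔ v = 0 := by
  rw [← norm_eq_zero, norm_wTil, mul_eq_zero, norm_eq_zero]
  exact ⟨fun h => h.resolve_left (wsc_pos v).ne', Or.inr⟩

/-- `w̃` is smooth. [folklore] -/
theorem contDiff_wTil : ContDiff ℝ ∞ wTil :=
  (Complex.ofRealCLM.contDiff.comp contDiff_wsc).mul contDiff_toC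

/-- The level `t(v) = 1/4 − ‖w̃(v)‖² ∈ (3/16, 1/4]` of the cut-off on the tube. [folklore] -/
def levT (v : 𝔼 2) : ℝ := 1 / 4 - ‖wTil v‖ ^ 2

/-- `3/16 < t(v)`. [folklore] -/
theorem levT_gt (v : 𝔼 2) : 3 / 16 < levT v := by
  have := norm_wTil_sq_lt v; unfold levT; linarith

/-- `t(v) ≤ 1/4`. [folklore] -/
theorem levT_le (v : 𝔼 2) : levT v ≤ 1 / 4 := by
  have := sq_nonneg ‖wTil v‖; unfold levT; linarith

/-- `0 < t(v)`. [folklore] -/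
theorem levT_pos (v : 𝔼 2) : 0 < levT v := lt_trans (by norm_num) (levT_gt v)

/-- `t(v) < 1`. [folklore] -/
theorem levT_lt_one (v : 𝔼 2) : levT v < 1 := (levT_le v).trans_lt (by norm_num)

/-- `t` is smooth. [folklore] -/
theorem contDiff_levT : ContDiff ℝ ∞ levT :=
  contDiff_const.sub (contDiff_norm_sq_complex.comp contDiff_wTil)

/-- **The squared radius `S(v) = etaInv (1/4 − ‖w̃ v‖²)` of the `x`-circle** of the level torus
`{rho = 1/4, w = w̃ v}`: `eta (S v) + ‖w̃ v‖² = 1/4`. [folklore] -/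
def radS (v : 𝔼 2) : ℝ := etaInv (levT v)

/-- `S(v) > 4`. [folklore] -/
theorem four_lt_radS (v : 𝔼 2) : 4 < radS v := four_lt_etaInv (levT_pos v) (levT_lt_one v)

/-- `eta (S v) = 1/4 − ‖w̃ v‖²`. [folklore] -/
theorem eta_radS (v : 𝔼 2) : eta (radS v) = 1 / 4 - ‖wTil v‖ ^ 2 :=
  eta_etaInv (levT_pos v) (levT_lt_one v)

/-- `S` is smooth. [folklore] -/
theorem contDiff_radS : ContDiff ℝ ∞ radS :=
  contDiff_iff_contDiffAt.2 fun v =>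
    (contDiffAt_etaInv (levT_pos v) (levT_lt_one v)).comp v contDiff_levT.contDiffAt

/-- **The radius `r(v) = √(S v) > 2`.** [folklore] -/
def rad (v : 𝔼 2) : ℝ := √(radS v)

/-- `r(v) > 2`. [folklore] -/
theorem two_lt_rad (v : 𝔼 2) : 2 < rad v := by
  rw [rad, show (2 : ℝ) = √4 by rw [show (4:ℝ) = 2 ^ 2 by norm_num, Real.sqrt_sq (by norm_num)]]
  exact Real.sqrt_lt_sqrt (by norm_num) (four_lt_radS v)

/-- `r(v) > 0`. [folklore] -/
theorem rad_pos (v : 𝔼 2) : 0 < rad v := lt_trans two_pos (two_lt_rad v)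

/-- `r(v)² = S(v)`. [folklore] -/
theorem rad_sq (v : 𝔼 2) : rad v ^ 2 = radS v := Real.sq_sqrt (by linarith [four_lt_radS v])

/-- `r` is smooth. [folklore] -/
theorem contDiff_rad : ContDiff ℝ ∞ rad :=
  contDiff_radS.sqrt fun v => (lt_trans four_pos (four_lt_radS v)).ne'

/-- `Q(v) = r(v)^{2g+1} ≥ 2`: the modulus of `x^{2g+1}` on the level torus. [folklore] -/
def radQ (g : ℕ) (v : 𝔼 2) : ℝ := rad v ^ (2 * g + 1)

/-- `Q(v) > 2`. [folklore] -/
theorem two_lt_radQ (g : ℕ) (v : 𝔼 2) : 2 < radQ g v := by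
  unfold radQ
  calc (2 : ℝ) = 2 ^ 1 := (pow_one _).symm
    _ ≤ 2 ^ (2 * g + 1) := pow_le_pow_right₀ (by norm_num) (by omega)
    _ < rad v ^ (2 * g + 1) := pow_lt_pow_left₀ (two_lt_rad v) (by norm_num) (by omega)

/-- `Q(v) > 0`. [folklore] -/
theorem radQ_pos (g : ℕ) (v : 𝔼 2) : 0 < radQ g v := lt_trans two_pos (two_lt_radQ g v)

/-- `Q` is smooth. [folklore] -/
theorem contDiff_radQ (g : ℕ) : ContDiff ℝ ∞ (radQ g) := contDiff_rad.pow _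

/-! ## §11 The tube in ambient coordinates -/

/-- The correction `z(P, v) = (1 + w̃ v) P̄^{4g+2} / Q(v)`, of modulus `≤ 5/8` for `‖P‖ = 1`.
[folklore] -/
def zCorr (g : ℕ) (P : ℂ) (v : 𝔼 2) : ℂ := (1 + wTil v) * conj P ^ (4 * g + 2) / (radQ g v : ℂ)

/-- `‖z(P, v)‖ < 5/8` for `‖P‖ = 1`. [folklore] -/
theorem norm_zCorr_lt (g : ℕ) {P : ℂ} (hP : ‖P‖ = 1) (v : 𝔼 2) : ‖zCorr g P v‖ < 5 / 8 := by
  have hQ := two_lt_radQ g v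
  have h1 : ‖1 + wTil v‖ < 5 / 4 := by
    have h := norm_add_le (1 : ℂ) (wTil v)
    rw [norm_one] at h
    linarith [norm_wTil_lt v]
  rw [zCorr, norm_div, norm_mul, norm_pow, Complex.norm_conj, hP, one_pow, mul_one,
    Complex.norm_real, Real.norm_eq_abs, abs_of_pos (radQ_pos g v), div_lt_iff₀ (radQ_pos g v)]
  nlinarith [norm_nonneg (1 + wTil v)]

/-- `1 + z(P, v)` has positive real part for `‖P‖ = 1`. [folklore] -/
theorem one_add_zCorr_re_pos (g : ℕ) {P : ℂ} (hP : ‖P‖ = 1) (v : 𝔼 2) :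
    0 < (1 + zCorr g P v).re := by
  have h := norm_zCorr_lt g hP v
  have h2 : |(zCorr g P v).re| ≤ ‖zCorr g P v‖ := Complex.abs_re_le_norm _
  rw [Complex.add_re, Complex.one_re]
  have := neg_abs_le (zCorr g P v).re
  linarith

/-- `1 + z(P, v)` lies in the slit plane for `‖P‖ = 1`. [folklore] -/
theorem one_add_zCorr_mem_slitPlane (g : ℕ) {P : ℂ} (hP : ‖P‖ = 1) (v : 𝔼 2) :
    1 + zCorr g P v ∈ slitPlane :=
  Or.inl (one_add_zCorr_re_pos g hP v)

/-- **The `x`-coordinate of the tube**: `x = r(v) P²`. [folklore] -/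
def tubeX (P : ℂ) (v : 𝔼 2) : ℂ := (rad v : ℂ) * P ^ 2

/-- **The `y`-coordinate of the tube**: `y = P^{2g+1} √Q(v) √(1 + z(P, v))`, the smooth square
root of `x^{2g+1} + 1 + w̃ v` along the doubled binding circle. [folklore] -/
def tubeY (g : ℕ) (P : ℂ) (v : 𝔼 2) : ℂ :=
  P ^ (2 * g + 1) * (√(radQ g v) : ℂ) * csqrt (1 + zCorr g P v)

/-- **The tube in ambient coordinates** `ℝ² × ℝ² → ℂ²`, `(p, v) ↦ (x, y)`. [folklore] -/
def tubeAmb (g : ℕ) (q : (𝔼 2) × (𝔼 2)) : 𝔼 4 := mk (tubeX (toC q.1) q.2) (tubeY g (toC q.1) q.2)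

/-- `x` of the tube. [folklore] -/
@[simp] theorem cx_tubeAmb (g : ℕ) (q : (𝔼 2) × (𝔼 2)) :
    cx (tubeAmb g q) = (rad q.2 : ℂ) * toC q.1 ^ 2 := cx_mk _ _

/-- `y` of the tube. [folklore] -/
@[simp] theorem cy_tubeAmb (g : ℕ) (q : (𝔼 2) × (𝔼 2)) :
    cy (tubeAmb g q) = tubeY g (toC q.1) q.2 := cy_mk _ _

/-- `P P̄ = 1` for a unit complex number. [folklore] -/
theorem mul_conj_of_norm_eq_one {P : ℂ} (hP : ‖P‖ = 1) : P * conj P = 1 := by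
  rw [Complex.mul_conj, Complex.normSq_eq_norm_sq, hP]; norm_num

/-- **`y² = x^{2g+1} + 1 + w̃`** on the tube over the unit circle. [folklore] -/
theorem tubeY_sq (g : ℕ) {P : ℂ} (hP : ‖P‖ = 1) (v : 𝔼 2) :
    tubeY g P v ^ 2 = tubeX P v ^ (2 * g + 1) + 1 + wTil v := by
  have hQ : ((√(radQ g v) : ℝ) : ℂ) ^ 2 = (radQ g v : ℂ) := by
    rw [← Complex.ofReal_pow, Real.sq_sqrt (radQ_pos g v).le]
  have hQ0 : (radQ g v : ℂ) ≠ 0 := Complex.ofReal_ne_zero.2 (radQ_pos g v).ne'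
  have hz : (radQ g v : ℂ) * zCorr g P v = (1 + wTil v) * conj P ^ (4 * g + 2) := by
    rw [zCorr, mul_div_cancel₀ _ hQ0]
  have hPc : (P * conj P) ^ (4 * g + 2) = 1 := by rw [mul_conj_of_norm_eq_one hP, one_pow]
  have hX : tubeX P v ^ (2 * g + 1) = (radQ g v : ℂ) * P ^ (4 * g + 2) := by
    rw [tubeX, mul_pow, ← pow_mul, radQ, Complex.ofReal_pow]; ring_nf
  calc tubeY g P v ^ 2
      = P ^ (4 * g + 2) * ((√(radQ g v) : ℝ) : ℂ) ^ 2 * (csqrt (1 + zCorr g P v)) ^ 2 := by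
        rw [tubeY]; ring
    _ = P ^ (4 * g + 2) * (radQ g v : ℂ) + P ^ (4 * g + 2) * ((radQ g v : ℂ) * zCorr g P v) := by
        rw [hQ, csqrt_sq]; ring
    _ = tubeX P v ^ (2 * g + 1) + 1 + wTil v := by
        rw [hz, hX, mul_pow] at *
        linear_combination (1 + wTil v) * hPc

/-- **`w = w̃(v)` on the tube** (over the unit circle). [folklore] -/
theorem w_tubeAmb (g : ℕ) {p : 𝔼 2} (hp : ‖toC p‖ = 1) (v : 𝔼 2) :
    w g (tubeAmb g (p, v)) = wTil v := by
  rw [w, Phi, cx_tubeAmb, cy_tubeAmb, tubeY_sq g hp]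
  simp only [tubeX]; ring

/-- `‖x‖² = S(v)` on the tube (over the unit circle). [folklore] -/
theorem norm_sq_cx_tubeAmb (g : ℕ) {p : 𝔼 2} (hp : ‖toC p‖ = 1) (v : 𝔼 2) :
    ‖cx (tubeAmb g (p, v))‖ ^ 2 = radS v := by
  rw [cx_tubeAmb, norm_mul, norm_pow, hp, one_pow, mul_one, Complex.norm_real, Real.norm_eq_abs,
    abs_of_pos (rad_pos v), rad_sq]

/-- **The tube lies on the level `rho = 1/4`** (over the unit circle). [folklore] -/
theorem rho_tubeAmb (g : ℕ) {p : 𝔼 2} (hp : ‖toC p‖ = 1) (v : 𝔼 2) :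
    rho g (tubeAmb g (p, v)) = 1 / 4 := by
  rw [rho, w_tubeAmb g hp, norm_sq_cx_tubeAmb g hp, eta_radS]; ring

/-- `x ≠ 0` on the tube (off `P = 0`). [folklore] -/
theorem cx_tubeAmb_ne_zero (g : ℕ) {p : 𝔼 2} (hp : toC p ≠ 0) (v : 𝔼 2) :
    cx (tubeAmb g (p, v)) ≠ 0 := by
  rw [cx_tubeAmb]
  exact mul_ne_zero (Complex.ofReal_ne_zero.2 (rad_pos v).ne') (pow_ne_zero _ hp)

/-- `y ≠ 0` on the tube (over the unit circle): `y² = x^{2g+1}(1 + z)` with both factors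
non-zero. [folklore] -/
theorem cy_tubeAmb_ne_zero (g : ℕ) {p : 𝔼 2} (hp : ‖toC p‖ = 1) (v : 𝔼 2) :
    cy (tubeAmb g (p, v)) ≠ 0 := by
  rw [cy_tubeAmb, tubeY]
  have hP : toC p ≠ 0 := fun h => by rw [h, norm_zero] at hp; exact zero_ne_one hp
  refine mul_ne_zero (mul_ne_zero (pow_ne_zero _ hP) ?_) (csqrt_ne_zero_of_ne_zero ?_)
  · exact Complex.ofReal_ne_zero.2 (Real.sqrt_pos.2 (radQ_pos g v)).ne'
  · intro h
    have := one_add_zCorr_re_pos g hp v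
    rw [h, Complex.zero_re] at this
    exact lt_irrefl _ this

/-- **The tube is smooth** at every point over the unit circle (the square root is taken in the
slit plane). [folklore] -/
theorem contDiffAt_tubeAmb (g : ℕ) {q : (𝔼 2) × (𝔼 2)} (hq : ‖toC q.1‖ = 1) :
    ContDiffAt ℝ ∞ (tubeAmb g) q := by
  have hP : ContDiff ℝ ∞ fun q : (𝔼 2) × (𝔼 2) => toC q.1 := contDiff_toC.comp contDiff_fst
  have hrad : ContDiff ℝ ∞ fun q : (𝔼 2) × (𝔼 2) => (rad q.2 : ℂ) :=
    Complex.ofRealCLM.contDiff.comp (contDiff_rad.comp contDiff_snd)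
  have hX : ContDiff ℝ ∞ fun q : (𝔼 2) × (𝔼 2) => tubeX (toC q.1) q.2 := hrad.mul (hP.pow 2)
  have hQ : ContDiff ℝ ∞ fun q : (𝔼 2) × (𝔼 2) => (radQ g q.2 : ℂ) :=
    Complex.ofRealCLM.contDiff.comp ((contDiff_radQ g).comp contDiff_snd)
  have hsQ : ContDiff ℝ ∞ fun q : (𝔼 2) × (𝔼 2) => ((√(radQ g q.2) : ℝ) : ℂ) :=
    Complex.ofRealCLM.contDiff.comp (((contDiff_radQ g).comp contDiff_snd).sqrt
      fun q => (radQ_pos g q.2).ne')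
  have hz : ContDiff ℝ ∞ fun q : (𝔼 2) × (𝔼 2) => zCorr g (toC q.1) q.2 := by
    have e : (fun q : (𝔼 2) × (𝔼 2) => zCorr g (toC q.1) q.2) = fun q =>
        (1 + wTil q.2) * conj (toC q.1) ^ (4 * g + 2) * ((radQ g q.2 : ℂ))⁻¹ := by
      funext q; rw [zCorr, div_eq_mul_inv]
    rw [e]
    refine ((contDiff_const.add (contDiff_wTil.comp contDiff_snd)).mul
      ((Complex.conjCLE.contDiff.comp hP).pow _)).mul (hQ.inv fun q => ?_)
    exact Complex.ofReal_ne_zero.2 (radQ_pos g q.2).ne'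
  have hsq : ContDiffAt ℝ ∞ (csqrt ∘ fun q : (𝔼 2) × (𝔼 2) => 1 + zCorr g (toC q.1) q.2) q :=
    ContDiffAt.comp q (contDiffAt_csqrt (one_add_zCorr_mem_slitPlane g hq q.2))
      (contDiff_const.add hz).contDiffAt
  have hY : ContDiffAt ℝ ∞ (fun q : (𝔼 2) × (𝔼 2) => tubeY g (toC q.1) q.2) q :=
    ((hP.pow _).mul hsQ).contDiffAt.mul hsq
  exact contDiffAt_mk hX.contDiffAt hY

/-- `z(−P, v) = z(P, v)` (the exponent `4g + 2` is even). [folklore] -/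
theorem zCorr_neg (g : ℕ) (P : ℂ) (v : 𝔼 2) : zCorr g (-P) v = zCorr g P v := by
  have h1 : (-1 : ℂ) ^ (4 * g + 2) = 1 := by
    rw [show 4 * g + 2 = 2 * (2 * g + 1) by ring]
    exact (even_two_mul (2 * g + 1)).neg_one_pow
  rw [zCorr, zCorr, map_neg, neg_pow, h1, one_mul]

/-- `x(−P, v) = x(P, v)`. [folklore] -/
theorem tubeX_neg (P : ℂ) (v : 𝔼 2) : tubeX (-P) v = tubeX P v := by
  rw [tubeX, tubeX, neg_sq]

/-- **`y(−P, v) = −y(P, v)`**: the antipodal parameter gives the other sheet. [folklore] -/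
theorem tubeY_neg (g : ℕ) (P : ℂ) (v : 𝔼 2) : tubeY g (-P) v = -tubeY g P v := by
  rw [tubeY, tubeY, zCorr_neg, neg_pow, (odd_two_mul_add_one g).neg_one_pow]
  ring

/-- `toC (−p) = −toC p`. [folklore] -/
theorem toC_neg (p : 𝔼 2) : toC (-p) = -toC p := by
  apply Complex.ext <;> simp [toC]

/-- The antipodal parameter gives the conjugate sheet: `tubeAmb (−p, v) = (x, −y)`. [folklore] -/
theorem tubeAmb_neg (g : ℕ) (p v : 𝔼 2) :
    tubeAmb g (-p, v) = mk (cx (tubeAmb g (p, v))) (-cy (tubeAmb g (p, v))) := by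
  rw [cx_tubeAmb, cy_tubeAmb, tubeAmb]
  simp only [toC_neg, tubeY_neg, tubeX, neg_sq]

/-- **Undoing the radial rescaling**: `u(w) = (4/√(1 − 16‖w‖²)) · w ∈ ℝ²`, the inverse of
`v ↦ w̃(v)` (on `‖w‖ < 1/4`). [folklore] -/
def unscale (w : ℂ) : 𝔼 2 := (4 / √(1 - 16 * ‖w‖ ^ 2)) • vec2 w

/-- `‖w̃ v‖² = ‖v‖²/(16(1 + ‖v‖²))`. [folklore] -/
theorem norm_wTil_sq (v : 𝔼 2) : ‖wTil v‖ ^ 2 = ‖v‖ ^ 2 / (16 * (1 + ‖v‖ ^ 2)) := by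
  rw [norm_wTil, mul_pow, wsc, inv_pow, mul_pow,
    Real.sq_sqrt (by positivity : (0 : ℝ) < 1 + ‖v‖ ^ 2).le]
  ring

/-- **`u (w̃ v) = v`.** [folklore] -/
theorem unscale_wTil (v : 𝔼 2) : unscale (wTil v) = v := by
  have h1 : 1 - 16 * ‖wTil v‖ ^ 2 = (1 + ‖v‖ ^ 2)⁻¹ := by
    rw [norm_wTil_sq]; field_simp; ring
  have h2 : √(1 - 16 * ‖wTil v‖ ^ 2) = (√(1 + ‖v‖ ^ 2))⁻¹ := by
    rw [h1, Real.sqrt_inv]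
  have hs : 0 < √(1 + ‖v‖ ^ 2) := Real.sqrt_pos.2 (by positivity : (0 : ℝ) < 1 + ‖v‖ ^ 2)
  rw [unscale, vec2_wTil, smul_smul, h2, wsc]
  rw [show 4 / (√(1 + ‖v‖ ^ 2))⁻¹ * (4 * √(1 + ‖v‖ ^ 2))⁻¹ = 1 by field_simp, one_smul]

/-- `w̃` is injective. [folklore] -/
theorem wTil_injective : Injective wTil := fun v v' h => by
  rw [← unscale_wTil v, h, unscale_wTil]

/-- `u` is smooth on `‖w‖² < 1/16`. [folklore] -/
theorem contDiffAt_unscale {w : ℂ} (hw : ‖w‖ ^ 2 < 1 / 16) : ContDiffAt ℝ ∞ unscale w := by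
  have h1 : ContDiff ℝ ∞ fun w : ℂ => 1 - 16 * ‖w‖ ^ 2 :=
    contDiff_const.sub (contDiff_const.mul contDiff_norm_sq_complex)
  have hpos : 0 < 1 - 16 * ‖w‖ ^ 2 := by linarith
  have h2 : ContDiffAt ℝ ∞ (fun w : ℂ => √(1 - 16 * ‖w‖ ^ 2)) w := h1.contDiffAt.sqrt hpos.ne'
  have h3 : ContDiffAt ℝ ∞ (fun w : ℂ => 4 / √(1 - 16 * ‖w‖ ^ 2)) w :=
    contDiffAt_const.div h2 (Real.sqrt_pos.2 hpos).ne'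
  exact h3.smul contDiff_vec2.contDiffAt

/-! ## §12 The binding tube `𝕊¹ × ℝ² → ∂ Base g` -/

/-- **The binding tube of the boundary open book**: `(p, v) ↦ (r(v) P², P^{2g+1} √Q √(1 + z))`,
`P = p₀ + i p₁`, as a map into the boundary 3-manifold `∂ Base g`; its core `v = 0` is the binding
`{w = 0} ∩ ∂ Base g` traversed once (a connected double cover of the circle `‖x‖² = etaInv (1/4)`),
and `w ∘ tube = w̃` points in the direction of `v`. [folklore] -/
def tube (g : ℕ) (q : 𝕊¹ × (𝔼 2)) : (bBase g).carrier :=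
  bPt g (tubeAmb g ((q.1 : 𝔼 2), q.2)) (rho_tubeAmb g (norm_toC_sphere q.1) q.2)

/-- The tube read in `ℂ²`. [folklore] -/
@[simp] theorem inclB_tube (g : ℕ) (q : 𝕊¹ × (𝔼 2)) :
    inclB g (tube g q) = tubeAmb g ((q.1 : 𝔼 2), q.2) := rfl

/-- `(p, v) ↦ (p, v) : 𝕊¹ × ℝ² → ℝ² × ℝ²` is smooth. [folklore] -/
theorem contMDiff_coe_prod :
    ContMDiff ((𝓡 1).prod 𝓘(ℝ, 𝔼 2)) 𝓘(ℝ, (𝔼 2) × (𝔼 2)) ∞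
      (fun q : 𝕊¹ × (𝔼 2) => ((q.1 : 𝔼 2), q.2)) :=
  ((contMDiff_coe_sphere (n := 1)).comp contMDiff_fst).prodMk_space contMDiff_snd

/-- **The tube is smooth.** [folklore] -/
theorem contMDiff_tube (g : ℕ) : ContMDiff ((𝓡 1).prod 𝓘(ℝ, 𝔼 2)) (𝓡 3) ∞ (tube g) :=
  contMDiff_bPt g _ fun q =>
    (contDiffAt_tubeAmb g (norm_toC_sphere q.1)).contMDiffAt.comp q (contMDiff_coe_prod q)

/-- The tube is continuous. [folklore] -/
theorem continuous_tube (g : ℕ) : Continuous (tube g) := (contMDiff_tube g).continuous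

/-- **`w ∘ tube = w̃`**: the normal form of the fibration in the tube. [folklore] -/
theorem w_tube (g : ℕ) (q : 𝕊¹ × (𝔼 2)) : w g (inclB g (tube g q)) = wTil q.2 :=
  w_tubeAmb g (norm_toC_sphere q.1) q.2

/-- `x ∘ tube = r(v) P²`. [folklore] -/
theorem cx_tube (g : ℕ) (q : 𝕊¹ × (𝔼 2)) :
    cx (inclB g (tube g q)) = (rad q.2 : ℂ) * toC (q.1 : 𝔼 2) ^ 2 := cx_tubeAmb g _

/-- `y ≠ 0` on the tube. [folklore] -/
theorem cy_tube_ne_zero (g : ℕ) (q : 𝕊¹ × (𝔼 2)) : cy (inclB g (tube g q)) ≠ 0 :=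
  cy_tubeAmb_ne_zero g (norm_toC_sphere q.1) q.2

/-- On the core, `w = 0`. [folklore] -/
theorem w_tube_core (g : ℕ) (p : 𝕊¹) : w g (inclB g (tube g (p, 0))) = 0 := by
  rw [w_tube, wTil_eq_zero_iff]

/-- **The tube is injective**: `w` recovers `v`, `x` recovers `P²`, and the sign of `y`
distinguishes `P` from `−P`. [folklore] -/
theorem tube_injective (g : ℕ) : Injective (tube g) := by
  rintro ⟨p, v⟩ ⟨p', v'⟩ h
  have hA : tubeAmb g ((p : 𝔼 2), v) = tubeAmb g ((p' : 𝔼 2), v') := congrArg (inclB g) h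
  have hv : v = v' := by
    have := congrArg (w g) hA
    rw [w_tubeAmb g (norm_toC_sphere p), w_tubeAmb g (norm_toC_sphere p')] at this
    exact wTil_injective this
  subst hv
  have hx := congrArg cx hA
  rw [cx_tubeAmb, cx_tubeAmb] at hx
  have hx' : toC (p : 𝔼 2) ^ 2 = toC (p' : 𝔼 2) ^ 2 :=
    mul_left_cancel₀ (Complex.ofReal_ne_zero.2 (rad_pos v).ne') hx
  rcases sq_eq_sq_iff_eq_or_eq_neg.1 hx' with hP | hP
  · have : (p : 𝔼 2) = (p' : 𝔼 2) := toC_injective hP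
    rw [Subtype.ext this]
  · exfalso
    have hy := congrArg cy hA
    have hp' : ((p' : 𝔼 2)) = -(p : 𝔼 2) := toC_injective (by rw [toC_neg, hP, neg_neg])
    rw [hp', show tubeAmb g (-(p : 𝔼 2), v) = mk (cx (tubeAmb g ((p : 𝔼 2), v)))
      (-cy (tubeAmb g ((p : 𝔼 2), v))) from tubeAmb_neg g _ _, cy_mk] at hy
    exact cy_tubeAmb_ne_zero g (norm_toC_sphere p) v (CharZero.eq_neg_self_iff.1 hy)

/-- **The tube avoids the binding off its core**: `tube (p, v) = tube (p', 0) → v = 0`.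
[folklore] -/
theorem tube_eq_core_imp (g : ℕ) (p p' : 𝕊¹) (v : 𝔼 2) (h : tube g (p, v) = tube g (p', 0)) :
    v = 0 := by
  have := congrArg (fun y => w g (inclB g y)) h
  simp only [w_tube] at this
  rw [(wTil_eq_zero_iff 0).2 rfl, wTil_eq_zero_iff] at this
  exact this

/-! ## §13 The image of the tube, its inverse, the tube is an open smooth embedding -/

/-- `toC (c • v) = c · toC v`. [folklore] -/
theorem toC_smul (c : ℝ) (v : 𝔼 2) : toC (c • v) = (c : ℂ) * toC v := by
  rw [← toC_vec2 ((c : ℂ) * toC v), vec2_ofReal_mul, vec2_toC]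

/-- **`w̃ (u w) = w` for `‖w‖ < 1/4`**: `u` inverts the radial rescaling. [folklore] -/
theorem wTil_unscale {w : ℂ} (hw : ‖w‖ < 1 / 4) : wTil (unscale w) = w := by
  have h16 : 0 < 1 - 16 * ‖w‖ ^ 2 := by nlinarith [norm_nonneg w]
  set μ : ℝ := 4 / √(1 - 16 * ‖w‖ ^ 2) with hμ
  have hs : 0 < √(1 - 16 * ‖w‖ ^ 2) := Real.sqrt_pos.2 h16
  have hμpos : 0 < μ := div_pos (by norm_num) hs
  have hn : ‖unscale w‖ ^ 2 = 16 * ‖w‖ ^ 2 / (1 - 16 * ‖w‖ ^ 2) := by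
    rw [unscale, norm_smul, norm_vec2, mul_pow, Real.norm_eq_abs, abs_of_pos hμpos, hμ, div_pow,
      Real.sq_sqrt h16.le]
    ring
  have h1 : 1 + ‖unscale w‖ ^ 2 = (1 - 16 * ‖w‖ ^ 2)⁻¹ := by
    rw [hn]; field_simp; ring
  have hwsc : wsc (unscale w) = μ⁻¹ := by
    rw [wsc, h1, Real.sqrt_inv, hμ]
    field_simp
  rw [wTil, hwsc, unscale, toC_smul, toC_vec2, ← hμ, ← mul_assoc, ← Complex.ofReal_mul,
    inv_mul_cancel₀ hμpos.ne', Complex.ofReal_one, one_mul]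

/-- **A point of `∂ Base g` with `‖w‖ < 1/4` lies in the tube**: `w` determines `v`, the level
equation determines `‖x‖² = S(v) > 4`, a square root `P` of `x/r(v)` is a unit complex number with
`x = r P²`, and `y = ±y(P, v) = y(±P, v)`. [folklore] -/
theorem exists_tube_eq (g : ℕ) {y : (bBase g).carrier} (hw : ‖w g (inclB g y)‖ < 1 / 4) :
    ∃ q, tube g q = y := by
  set q₀ := inclB g y with hq₀
  set v := unscale (w g q₀) with hv
  have hwv : wTil v = w g q₀ := wTil_unscale hw
  have hrho : rho g q₀ = 1 / 4 := rho_inclB g y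
  -- the level equation: `‖x‖² = S(v)`
  have heta : eta (‖cx q₀‖ ^ 2) = levT v := by
    rw [levT, hwv]; rw [rho] at hrho; linarith
  have hx4 : 4 < ‖cx q₀‖ ^ 2 := by
    by_contra h
    rw [eta_of_le (not_lt.1 h)] at heta
    exact (levT_pos v).ne heta
  have hxS : ‖cx q₀‖ ^ 2 = radS v := by
    rw [radS, ← heta, etaInv_eta hx4]
  have hxr : ‖cx q₀‖ = rad v := by
    rw [← Real.sqrt_sq (norm_nonneg (cx q₀)), hxS, rad]
  have hx0 : cx q₀ ≠ 0 := by
    rw [← norm_pos_iff, hxr]; exact rad_pos v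
  -- the square root `P` of `x / r`
  set P := csqrt (cx q₀ / rad v) with hP
  have hP2 : P ^ 2 = cx q₀ / rad v := csqrt_sq _
  have hP1 : ‖P‖ = 1 := by
    have h : ‖P‖ ^ 2 = 1 := by
      rw [norm_csqrt_sq, norm_div, Complex.norm_real, Real.norm_eq_abs, abs_of_pos (rad_pos v), hxr,
        div_self (rad_pos v).ne']
    exact (pow_eq_one_iff_of_nonneg (norm_nonneg _) two_ne_zero).1 h
  have hX : tubeX P v = cx q₀ := by
    rw [tubeX, hP2, mul_div_cancel₀ _ (Complex.ofReal_ne_zero.2 (rad_pos v).ne')]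
  have hY2 : tubeY g P v ^ 2 = cy q₀ ^ 2 := by
    rw [tubeY_sq g hP1, hX, hwv, w, Phi]; ring
  -- the point of the circle and the sheet
  have key : ∀ P' : ℂ, ‖P'‖ = 1 → tubeX P' v = cx q₀ → tubeY g P' v = cy q₀ →
      ∃ q, tube g q = y := by
    intro P' hP'1 hX' hY'
    refine ⟨(⟨vec2 P', vec2_mem_sphere hP'1⟩, v), inclB_injective g ?_⟩
    rw [inclB_tube, ← hq₀, ← mk_cx_cy q₀]
    show tubeAmb g (vec2 P', v) = mk (cx q₀) (cy q₀)
    rw [tubeAmb]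
    simp only [toC_vec2, hX', hY']
  rcases sq_eq_sq_iff_eq_or_eq_neg.1 hY2 with h | h
  · exact key P hP1 hX h
  · refine key (-P) (by rw [norm_neg, hP1]) (by rw [tubeX_neg, hX]) ?_
    rw [tubeY_neg, h, neg_neg]

/-- **The image of the tube is `{‖w‖ < 1/4}`**, an open solid torus around the binding.
[folklore] -/
theorem range_tube (g : ℕ) : range (tube g) = {y | ‖w g (inclB g y)‖ < 1 / 4} := by
  ext y
  constructor
  · rintro ⟨q, rfl⟩
    show ‖w g (inclB g (tube g q))‖ < 1 / 4
    rw [w_tube]; exact norm_wTil_lt q.2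
  · exact fun hy => exists_tube_eq g hy

/-- The image of the tube is open. [folklore] -/
theorem isOpen_range_tube (g : ℕ) : IsOpen (range (tube g)) := by
  rw [range_tube]
  exact isOpen_lt (continuous_norm.comp ((contDiff_w g).continuous.comp (continuous_inclB g)))
    continuous_const

/-- **The circle parameter recovered from the ambient point**:
`P(x, y) = y x̄^g / (‖x‖^g √(‖x‖^{2g+1}) √(y²/x^{2g+1}))`; on the tube, `y²/x^{2g+1} = 1 + z` has
positive real part, its principal square root is the factor `√(1 + z)` of `y`, and the quotient
collapses to `P^{2g+1} P̄^{2g} = P`. [folklore] -/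
def parP (g : ℕ) (q : 𝔼 4) : ℂ :=
  cy q * conj (cx q) ^ g /
    ((((‖cx q‖ ^ g * √(‖cx q‖ ^ (2 * g + 1)) : ℝ)) : ℂ) * csqrt (cy q ^ 2 / cx q ^ (2 * g + 1)))

/-- On the tube, `y² / x^{2g+1} = 1 + z`. [folklore] -/
theorem cy_sq_div_tubeAmb (g : ℕ) {p : 𝔼 2} (hp : ‖toC p‖ = 1) (v : 𝔼 2) :
    cy (tubeAmb g (p, v)) ^ 2 / cx (tubeAmb g (p, v)) ^ (2 * g + 1) = 1 + zCorr g (toC p) v := by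
  have hP : toC p ≠ 0 := fun h => by rw [h, norm_zero] at hp; exact zero_ne_one hp
  have hQ : ((√(radQ g v) : ℝ) : ℂ) ^ 2 = (radQ g v : ℂ) := by
    rw [← Complex.ofReal_pow, Real.sq_sqrt (radQ_pos g v).le]
  have hr0 : (rad v : ℂ) ≠ 0 := Complex.ofReal_ne_zero.2 (rad_pos v).ne'
  rw [cy_tubeAmb, cx_tubeAmb, tubeY, mul_pow, mul_pow, hQ, csqrt_sq, radQ, Complex.ofReal_pow,
    mul_pow, ← pow_mul, ← pow_mul]
  field_simp
  ring_nf

/-- **`P (tube (p, v)) = P`.** [folklore] -/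
theorem parP_tubeAmb (g : ℕ) {p : 𝔼 2} (hp : ‖toC p‖ = 1) (v : 𝔼 2) :
    parP g (tubeAmb g (p, v)) = toC p := by
  set P := toC p with hPdef
  set ψ := csqrt (1 + zCorr g P v) with hψ
  have hP0 : P ≠ 0 := fun h => by rw [h, norm_zero] at hp; exact zero_ne_one hp
  have hψ0 : ψ ≠ 0 := by
    have := csqrt_re_pos (one_add_zCorr_re_pos g hp v)
    intro h; rw [hψ] at h; rw [h, Complex.zero_re] at this; exact lt_irrefl _ this
  have hnorm : ‖cx (tubeAmb g (p, v))‖ = rad v := by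
    rw [cx_tubeAmb, norm_mul, norm_pow, ← hPdef, hp, one_pow, mul_one, Complex.norm_real,
      Real.norm_eq_abs, abs_of_pos (rad_pos v)]
  have hreal : (‖cx (tubeAmb g (p, v))‖ ^ g * √(‖cx (tubeAmb g (p, v))‖ ^ (2 * g + 1)) : ℝ) =
      rad v ^ g * √(radQ g v) := by rw [hnorm, radQ]
  have hr0 : (rad v : ℂ) ≠ 0 := Complex.ofReal_ne_zero.2 (rad_pos v).ne'
  have hsQ0 : ((√(radQ g v) : ℝ) : ℂ) ≠ 0 :=
    Complex.ofReal_ne_zero.2 (Real.sqrt_pos.2 (radQ_pos g v)).ne'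
  have hPc : P * conj P = 1 := mul_conj_of_norm_eq_one hp
  rw [parP, cy_sq_div_tubeAmb g hp, ← hPdef, ← hψ, hreal, cy_tubeAmb, cx_tubeAmb, ← hPdef, tubeY,
    ← hψ, map_mul, Complex.conj_ofReal, map_pow, Complex.ofReal_mul, Complex.ofReal_pow]
  field_simp
  have e : P ^ (2 * g + 1) * conj P ^ (2 * g) = P := by
    calc P ^ (2 * g + 1) * conj P ^ (2 * g) = P * (P * conj P) ^ (2 * g) := by ring
      _ = P := by rw [hPc, one_pow, mul_one]
  linear_combination (↑(rad v) : ℂ) ^ g * e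

/-- **`P` is smooth near the tube** (`x ≠ 0` and `y²/x^{2g+1}` in the slit plane there).
[folklore] -/
theorem contDiffAt_parP (g : ℕ) {q : 𝔼 4} (hx : cx q ≠ 0)
    (hslit : cy q ^ 2 / cx q ^ (2 * g + 1) ∈ slitPlane) : ContDiffAt ℝ ∞ (parP g) q := by
  have hnum : ContDiff ℝ ∞ fun q : 𝔼 4 => cy q * conj (cx q) ^ g :=
    contDiff_cy.mul ((Complex.conjCLE.contDiff.comp contDiff_cx).pow g)
  have hn : ContDiffAt ℝ ∞ (fun q : 𝔼 4 => ‖cx q‖) q :=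
    (contDiffAt_norm ℝ hx).comp q contDiff_cx.contDiffAt
  have hxpos : 0 < ‖cx q‖ := norm_pos_iff.2 hx
  have hreal : ContDiffAt ℝ ∞ (fun q : 𝔼 4 => ‖cx q‖ ^ g * √(‖cx q‖ ^ (2 * g + 1))) q :=
    (hn.pow g).mul ((hn.pow _).sqrt (pow_pos hxpos _).ne')
  have hrealC : ContDiffAt ℝ ∞
      (fun q : 𝔼 4 => (((‖cx q‖ ^ g * √(‖cx q‖ ^ (2 * g + 1)) : ℝ)) : ℂ)) q :=
    Complex.ofRealCLM.contDiff.contDiffAt.comp q hreal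
  have hratio : ContDiffAt ℝ ∞ (fun q : 𝔼 4 => cy q ^ 2 / cx q ^ (2 * g + 1)) q := by
    have e : (fun q : 𝔼 4 => cy q ^ 2 / cx q ^ (2 * g + 1)) =
        fun q => cy q ^ 2 * (cx q ^ (2 * g + 1))⁻¹ := by
      funext q; rw [div_eq_mul_inv]
    rw [e]
    exact (contDiff_cy.pow 2).contDiffAt.mul ((contDiff_cx.pow _).contDiffAt.inv (pow_ne_zero _ hx))
  have hcs : ContDiffAt ℝ ∞ (csqrt ∘ fun q : 𝔼 4 => cy q ^ 2 / cx q ^ (2 * g + 1)) q :=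
    ContDiffAt.comp q (contDiffAt_csqrt hslit) hratio
  have hden : ContDiffAt ℝ ∞ (fun q : 𝔼 4 => (((‖cx q‖ ^ g * √(‖cx q‖ ^ (2 * g + 1)) : ℝ)) : ℂ) *
      csqrt (cy q ^ 2 / cx q ^ (2 * g + 1))) q :=
    hrealC.mul hcs
  have hden0 : (((‖cx q‖ ^ g * √(‖cx q‖ ^ (2 * g + 1)) : ℝ)) : ℂ) *
      csqrt (cy q ^ 2 / cx q ^ (2 * g + 1)) ≠ 0 := by
    refine mul_ne_zero (Complex.ofReal_ne_zero.2 (mul_pos (pow_pos hxpos _)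
      (Real.sqrt_pos.2 (pow_pos hxpos _))).ne') (csqrt_ne_zero_of_ne_zero (slitPlane_ne_zero hslit))
  have e : parP g = fun q => cy q * conj (cx q) ^ g *
      ((((‖cx q‖ ^ g * √(‖cx q‖ ^ (2 * g + 1)) : ℝ)) : ℂ) *
        csqrt (cy q ^ 2 / cx q ^ (2 * g + 1)))⁻¹ := by
    funext q; rw [parP, div_eq_mul_inv]
  rw [e]
  exact hnum.contDiffAt.mul (hden.inv hden0)

/-- At a point of the tube, `P` is smooth. [folklore] -/
theorem contDiffAt_parP_tubeAmb (g : ℕ) {p : 𝔼 2} (hp : ‖toC p‖ = 1) (v : 𝔼 2) :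
    ContDiffAt ℝ ∞ (parP g) (tubeAmb g (p, v)) := by
  have hP : toC p ≠ 0 := fun h => by rw [h, norm_zero] at hp; exact zero_ne_one hp
  refine contDiffAt_parP g (cx_tubeAmb_ne_zero g hP v) ?_
  rw [cy_sq_div_tubeAmb g hp]
  exact one_add_zCorr_mem_slitPlane g hp v

/-- **The inverse of the tube** (on its image): `y ↦ (P/‖P‖, u(w))`. [folklore] -/
def tubeInv (g : ℕ) (y : (bBase g).carrier) : 𝕊¹ × (𝔼 2) :=
  (RotationBody.sphN (m := 1) (vec2 (parP g (inclB g y))), unscale (w g (inclB g y)))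

/-- `tubeInv ∘ tube = id`. [folklore] -/
theorem tubeInv_tube (g : ℕ) (q : 𝕊¹ × (𝔼 2)) : tubeInv g (tube g q) = q := by
  obtain ⟨p, v⟩ := q
  simp only [tubeInv, inclB_tube]
  rw [parP_tubeAmb g (norm_toC_sphere p), vec2_toC, RotationBody.sphN_coe,
    w_tubeAmb g (norm_toC_sphere p), unscale_wTil]

/-- `tube ∘ tubeInv = id` on the image of the tube. [folklore] -/
theorem tube_tubeInv (g : ℕ) {y : (bBase g).carrier} (hy : y ∈ range (tube g)) :
    tube g (tubeInv g y) = y := by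
  obtain ⟨q, rfl⟩ := hy
  rw [tubeInv_tube]

/-- `w ∘ inclB` is smooth on `∂ Base g`. [folklore] -/
theorem contMDiff_w_inclB (g : ℕ) : ContMDiff (𝓡 3) 𝓘(ℝ, ℂ) ∞ fun y => w g (inclB g y) :=
  (contDiff_w g).contMDiff.comp (contMDiff_inclB g)

/-- **The inverse of the tube is smooth on the image of the tube.** [folklore] -/
theorem contMDiffOn_tubeInv (g : ℕ) :
    ContMDiffOn (𝓡 3) ((𝓡 1).prod 𝓘(ℝ, 𝔼 2)) ∞ (tubeInv g) (range (tube g)) := by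
  rintro _ ⟨⟨p, v⟩, rfl⟩
  apply ContMDiffAt.contMDiffWithinAt
  have hp := norm_toC_sphere p
  -- second component
  have h2 : ContMDiffAt (𝓡 3) 𝓘(ℝ, 𝔼 2) ∞ (unscale ∘ fun y => w g (inclB g y)) (tube g (p, v)) := by
    refine ContMDiffAt.comp _ (contDiffAt_unscale ?_).contMDiffAt (contMDiff_w_inclB g _)
    show ‖w g (inclB g (tube g (p, v)))‖ ^ 2 < 1 / 16
    rw [w_tube]; exact norm_wTil_sq_lt v
  -- first component
  have h1a : ContMDiffAt (𝓡 3) 𝓘(ℝ, 𝔼 2) ∞ ((vec2 ∘ parP g) ∘ inclB g) (tube g (p, v)) :=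
    ContMDiffAt.comp _
      (contDiff_vec2.contDiffAt.comp _ (contDiffAt_parP_tubeAmb g hp v)).contMDiffAt
      (contMDiff_inclB g _)
  have hne : ((vec2 ∘ parP g) ∘ inclB g) (tube g (p, v)) ≠ 0 := by
    show vec2 (parP g (inclB g (tube g (p, v)))) ≠ 0
    rw [inclB_tube, parP_tubeAmb g hp, vec2_toC]
    exact ne_zero_of_mem_unit_sphere p
  have h1 : ContMDiffAt (𝓡 3) (𝓡 1) ∞
      (RotationBody.sphN (m := 1) ∘ ((vec2 ∘ parP g) ∘ inclB g)) (tube g (p, v)) :=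
    ContMDiffAt.comp _ (RotationBody.contMDiffOn_sphN.contMDiffAt (isOpen_ne.mem_nhds hne)) h1a
  exact h1.prodMk h2

/-- **The tube is an open map** (continuous inverse on its open image). [folklore] -/
theorem isOpenMap_tube (g : ℕ) : IsOpenMap (tube g) := by
  -- adapted from `SphereOpenBook.isOpenMap_tube`
  -- (Literature/Geometry/Symplectic/SphereOpenBookTube.lean)
  intro U hU
  have hcont : ContinuousOn (tubeInv g) (range (tube g)) := (contMDiffOn_tubeInv g).continuousOn
  have h : tube g '' U = range (tube g) ∩ tubeInv g ⁻¹' U := by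
    ext z
    constructor
    · rintro ⟨q, hq, rfl⟩
      exact ⟨mem_range_self q, by rwa [mem_preimage, tubeInv_tube]⟩
    · rintro ⟨⟨q, rfl⟩, hz⟩
      rw [mem_preimage, tubeInv_tube] at hz
      exact ⟨q, hz, rfl⟩
  rw [h]
  exact hcont.isOpen_inter_preimage (isOpen_range_tube g) hU

/-- `ℝ¹ × ℝ² ≅ ℝ³` (dimension count for the embedding criterion). [folklore] -/
def modelEquiv₁₂ : ((𝔼 1) × (𝔼 2)) ≃L[ℝ] (𝔼 3) :=
  ContinuousLinearEquiv.ofFinrankEq (by simp [Module.finrank_prod])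

/-- **The tube is a `C^∞` embedding** (injective open `C^∞` map with a `C^∞` inverse on its
range; Lee 2013, Prop. 5.2, tree `isSmoothEmbedding_of_leftInverse_of_isOpenMap`).
[cite: LeeSmoothManifolds2013, Prop. 5.2] -/
theorem isSmoothEmbedding_tube (g : ℕ) :
    Manifold.IsSmoothEmbedding ((𝓡 1).prod 𝓘(ℝ, 𝔼 2)) (𝓡 3) ∞ (tube g) :=
  (Literature.Geometry.Manifold.isSmoothEmbedding_of_leftInverse_of_isOpenMap (contMDiff_tube g)
    (tube_injective g) (isOpenMap_tube g) (contMDiffOn_tubeInv g) (tubeInv_tube g) modelEquiv₁₂).1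

/-! ## §14 The binding `{w = 0}` and the fibration `π = w/‖w‖` -/

section Fibration

open Literature.Geometry.Symplectic

/-- **The binding of the one-tube family is `{w = 0} ∩ ∂ Base g`** — the boundary circle of the
central page, traversed once by the core of the tube. [folklore] -/
theorem tubesBinding_tube (g : ℕ) :
    tubesBinding (fun _ : Fin 1 => tube g) = {y | w g (inclB g y) = 0} := by
  ext y
  rw [mem_tubesBinding_iff, mem_setOf_eq]
  constructor
  · rintro ⟨-, p, rfl⟩
    exact w_tube_core g p
  · intro hy
    have hlt : ‖w g (inclB g y)‖ < 1 / 4 := by rw [hy, norm_zero]; norm_num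
    obtain ⟨⟨p, v⟩, hq⟩ := exists_tube_eq g hlt
    have hv : v = 0 := by
      have := w_tube g (p, v)
      rw [hq, hy] at this
      exact (wTil_eq_zero_iff v).1 this.symm
    subst hv
    exact ⟨0, p, hq⟩

/-- **The fibration `π = w/‖w‖ : ∂ Base g → 𝕊¹`** (junk value on the binding `w = 0`): the
argument of `w = y² − x^{2g+1} − 1`, whose fibres on the flat part `‖x‖² < 4` of the boundary
(where `‖w‖ = 1/2`) are the pages `page g c = {w = c/2}`. [cite: EtnyreFuller2006, §2] -/
def proj (g : ℕ) (y : (bBase g).carrier) : 𝕊¹ :=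
  RotationBody.sphN (m := 1) (vec2 (w g (inclB g y)))

/-- Off the binding, `π(y) = w/‖w‖` read in `ℝ²`. [folklore] -/
theorem coe_proj (g : ℕ) {y : (bBase g).carrier} (hy : w g (inclB g y) ≠ 0) :
    ((proj g y : 𝕊¹) : 𝔼 2) = ‖w g (inclB g y)‖⁻¹ • vec2 (w g (inclB g y)) := by
  rw [proj, RotationBody.coe_sphN ((vec2_eq_zero_iff _).not.2 hy), norm_vec2]

/-- **Normal form of the fibration in the tube**: `π (tube (p, v)) = v/‖v‖` for `v ≠ 0`.
[folklore] -/
theorem proj_tube (g : ℕ) (p : 𝕊¹) {v : 𝔼 2} (hv : v ≠ 0) :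
    ((proj g (tube g (p, v)) : 𝕊¹) : 𝔼 2) = ‖v‖⁻¹ • v := by
  have h : vec2 (w g (inclB g (tube g (p, v)))) = wsc v • v := by rw [w_tube, vec2_wTil]
  rw [proj, h, RotationBody.sphN_smul (wsc_pos v) hv, RotationBody.coe_sphN hv]

/-- **`π` is smooth off the binding.** [folklore] -/
theorem contMDiffOn_proj (g : ℕ) :
    ContMDiffOn (𝓡 3) (𝓡 1) ∞ (proj g) {y | w g (inclB g y) ≠ 0} :=
  RotationBody.contMDiffOn_sphN.comp
    (contDiff_vec2.contMDiff.comp (contMDiff_w_inclB g)).contMDiffOn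
    fun _ hy => (vec2_eq_zero_iff _).not.2 hy

/-- The complement of the binding is open. [folklore] -/
theorem isOpen_w_ne_zero (g : ℕ) : IsOpen {y : (bBase g).carrier | w g (inclB g y) ≠ 0} :=
  isOpen_ne.preimage ((contDiff_w g).continuous.comp (continuous_inclB g))

/-- `π` is smooth at every point off the binding. [folklore] -/
theorem contMDiffAt_proj (g : ℕ) {y : (bBase g).carrier} (hy : w g (inclB g y) ≠ 0) :
    ContMDiffAt (𝓡 3) (𝓡 1) ∞ (proj g) y :=
  (contMDiffOn_proj g).contMDiffAt ((isOpen_w_ne_zero g).mem_nhds hy)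

/-- `π` read in `ℝ²` is smooth at every point off the binding. [folklore] -/
theorem contMDiffAt_coe_proj (g : ℕ) {y : (bBase g).carrier} (hy : w g (inclB g y) ≠ 0) :
    ContMDiffAt (𝓡 3) 𝓘(ℝ, 𝔼 2) ∞ (fun z => ((proj g z : 𝕊¹) : 𝔼 2)) y :=
  ((contMDiff_coe_sphere (n := 1)) _).comp y (contMDiffAt_proj g hy)

end Fibration

/-! ## §15 `π` is a submersion off the binding: curves along which `arg w` turns -/

section Submersion

open Literature.Geometry.Symplectic

/-- **The angular differential of `π` along a curve.**  If `γ` is a curve in `∂ Base g` through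
`y₀ ∉ B`, smooth at `0`, along which `w` turns as `w(γ(t)) = e^{i c(t)} w(y₀)` with `c(0) = 0`,
`c'(0) = k ≠ 0`, then `dθ_{y₀}(γ'(0)) = k ≠ 0`: by the chain rule `dθ(γ'(0))` is the angle form at
`w₀/‖w₀‖` applied to the velocity `k · i w₀/‖w₀‖` of `t ↦ e^{ic(t)} w₀/‖w₀‖`. [folklore] -/
theorem angularDeriv_proj_ne_zero_of_curve (g : ℕ) (γ : ℝ → (bBase g).carrier)
    (hw : w g (inclB g (γ 0)) ≠ 0) (hγ : ContMDiffAt 𝓘(ℝ, ℝ) (𝓡 3) ∞ γ 0)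
    {c : ℝ → ℝ} {k : ℝ} (hc : HasDerivAt c k 0) (hc0 : c 0 = 0) (hk : k ≠ 0)
    (hwγ : ∀ t, w g (inclB g (γ t)) = cexp (c t * I) * w g (inclB g (γ 0))) :
    angularDeriv (proj g) (γ 0) ≠ 0 := by
  set w₀ := w g (inclB g (γ 0)) with hw₀
  set u₀ : ℂ := ((‖w₀‖⁻¹ : ℝ) : ℂ) * w₀ with hu₀
  -- the composite `t ↦ π (γ t)` read in `ℝ²`
  have hF : ((fun z => ((proj g z : 𝕊¹) : 𝔼 2)) ∘ γ) = fun t => vec2 (cexp (c t * I) * u₀) := by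
    funext t
    have hwt : w g (inclB g (γ t)) ≠ 0 := by
      rw [hwγ t]; exact mul_ne_zero (Complex.exp_ne_zero _) hw
    rw [comp_apply, coe_proj g hwt, hwγ t, norm_mul, Complex.norm_exp_ofReal_mul_I, one_mul,
      ← vec2_ofReal_mul]
    congr 1
    rw [hu₀]; ring
  -- its derivative at `0`
  have hd : HasDerivAt (fun t => vec2 (cexp (c t * I) * u₀)) (vec2 ((k : ℂ) * I * u₀)) 0 := by
    have h1 : HasDerivAt (fun t => cexp (c t * I)) (cexp (c 0 * I) * ((k : ℂ) * I)) 0 :=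
      (hc.ofReal_comp.mul_const I).cexp
    rw [hc0, Complex.ofReal_zero, zero_mul, Complex.exp_zero, one_mul] at h1
    have h2 : HasDerivAt (fun t => cexp (c t * I) * u₀) ((k : ℂ) * I * u₀) 0 := h1.mul_const u₀
    have h3 := vec2L.hasFDerivAt.comp_hasDerivAt (0 : ℝ) h2
    simpa only [comp_def, vec2L_apply] using h3
  -- chain rule for `π ∘ γ`
  have hprojd : MDifferentiableAt (𝓡 3) 𝓘(ℝ, 𝔼 2) (fun z => ((proj g z : 𝕊¹) : 𝔼 2)) (γ 0) :=
    (contMDiffAt_coe_proj g hw).mdifferentiableAt (by simp)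
  have hγd : MDifferentiableAt 𝓘(ℝ, ℝ) (𝓡 3) γ 0 := hγ.mdifferentiableAt (by simp)
  have hcomp := mfderiv_comp 0 hprojd hγd
  intro hzero
  have h : angularDeriv (proj g) (γ 0) (mfderiv 𝓘(ℝ, ℝ) (𝓡 3) γ 0 (1 : ℝ)) = 0 := by
    rw [hzero]; rfl
  rw [angularDeriv_apply] at h
  have e1 : mfderiv (𝓡 3) 𝓘(ℝ, 𝔼 2) (fun z => ((proj g z : 𝕊¹) : 𝔼 2)) (γ 0)
      (mfderiv 𝓘(ℝ, ℝ) (𝓡 3) γ 0 (1 : ℝ)) =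
      mfderiv 𝓘(ℝ, ℝ) 𝓘(ℝ, 𝔼 2) ((fun z => ((proj g z : 𝕊¹) : 𝔼 2)) ∘ γ) 0 (1 : ℝ) := by
    rw [hcomp]; rfl
  rw [e1, hF, mfderiv_eq_fderiv] at h
  -- `fderiv F 0 1 = deriv F 0` (definitional), and `deriv F 0 = vec2 (k i u₀)`
  have h' : angleForm ((proj g (γ 0) : 𝕊¹) : 𝔼 2)
      (deriv (fun t => vec2 (cexp (c t * I) * u₀)) 0) = 0 := h
  -- evaluate the angle form: `dφ_{u₀}(k i u₀) = k ‖u₀‖² = k`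
  have hp : ((proj g (γ 0) : 𝕊¹) : 𝔼 2) = vec2 u₀ := by
    have := congrFun hF 0
    rw [comp_apply, hc0, Complex.ofReal_zero, zero_mul, Complex.exp_zero, one_mul] at this
    exact this
  rw [hd.deriv, hp, angleForm_apply] at h'
  simp only [vec2_apply_zero, vec2_apply_one, Complex.mul_re, Complex.mul_im, Complex.I_re,
    Complex.I_im, Complex.ofReal_re, Complex.ofReal_im, mul_zero, zero_mul, mul_one, sub_zero,
    zero_add, add_zero] at h'
  have hu : ‖u₀‖ = 1 := by
    rw [hu₀, norm_mul, Complex.norm_real, Real.norm_eq_abs,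
      abs_of_pos (inv_pos.2 (norm_pos_iff.2 hw)), inv_mul_cancel₀ (norm_ne_zero_iff.2 hw)]
  have hu2 : u₀.re * u₀.re + u₀.im * u₀.im = 1 := by
    rw [← Complex.normSq_apply, Complex.normSq_eq_norm_sq, hu, one_pow]
  apply hk
  have : k * (u₀.re * u₀.re + u₀.im * u₀.im) = 0 := by linear_combination h'
  rw [hu2, mul_one] at this
  exact this

/-! ### The curve at points with `y ≠ 0`: `x` fixed, `y(t)² = x^{2g+1} + 1 + e^{it} w₀` -/

/-- **Curve A** through `q₀ = (x₀, y₀)` with `y₀ ≠ 0`: `x = x₀`,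
`y = y₀ √(1 + (e^{it} − 1) w₀/y₀²)`, so that `w = e^{it} w₀` and `rho` is constant. [folklore] -/
def curveA (g : ℕ) (q₀ : 𝔼 4) (t : ℝ) : 𝔼 4 :=
  mk (cx q₀) (cy q₀ * csqrt (1 + (cexp (t * I) - 1) * (w g q₀ / cy q₀ ^ 2)))

/-- `y(t)² = y₀² + (e^{it} − 1) w₀` along curve A. [folklore] -/
theorem cy_curveA_sq (g : ℕ) {q₀ : 𝔼 4} (hy : cy q₀ ≠ 0) (t : ℝ) :
    cy (curveA g q₀ t) ^ 2 = cy q₀ ^ 2 + (cexp (t * I) - 1) * w g q₀ := by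
  rw [curveA, cy_mk, mul_pow, csqrt_sq]
  field_simp

/-- **`w = e^{it} w₀` along curve A.** [folklore] -/
theorem w_curveA (g : ℕ) {q₀ : 𝔼 4} (hy : cy q₀ ≠ 0) (t : ℝ) :
    w g (curveA g q₀ t) = cexp (t * I) * w g q₀ := by
  have h0 : w g q₀ = cy q₀ ^ 2 - cx q₀ ^ (2 * g + 1) - 1 := rfl
  rw [w, Phi, cy_curveA_sq g hy, curveA, cx_mk, h0]
  ring

/-- Curve A stays on the level of `q₀`. [folklore] -/
theorem rho_curveA (g : ℕ) {q₀ : 𝔼 4} (hy : cy q₀ ≠ 0) (t : ℝ) :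
    rho g (curveA g q₀ t) = rho g q₀ := by
  rw [rho, rho, w_curveA g hy, norm_mul, Complex.norm_exp_ofReal_mul_I, one_mul, curveA, cx_mk]

/-- Curve A starts at `q₀`. [folklore] -/
theorem curveA_zero (g : ℕ) (q₀ : 𝔼 4) : curveA g q₀ 0 = q₀ := by
  rw [curveA, Complex.ofReal_zero, zero_mul, Complex.exp_zero, sub_self, zero_mul, add_zero,
    csqrt_one_eq_one, mul_one, mk_cx_cy]

/-- Curve A is smooth at `t = 0` (the square root is taken near `1`). [folklore] -/
theorem contDiffAt_curveA (g : ℕ) (q₀ : 𝔼 4) : ContDiffAt ℝ ∞ (curveA g q₀) 0 := by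
  have hin : ContDiff ℝ ∞ fun t : ℝ => 1 + (cexp (t * I) - 1) * (w g q₀ / cy q₀ ^ 2) :=
    contDiff_const.add (((Complex.contDiff_exp.comp
      (Complex.ofRealCLM.contDiff.mul contDiff_const)).sub contDiff_const).mul contDiff_const)
  have h1 : (1 : ℂ) + (cexp ((0 : ℝ) * I) - 1) * (w g q₀ / cy q₀ ^ 2) ∈ slitPlane := by
    rw [Complex.ofReal_zero, zero_mul, Complex.exp_zero, sub_self, zero_mul, add_zero]
    exact Or.inl (by norm_num)
  have hsq : ContDiffAt ℝ ∞
      (csqrt ∘ fun t : ℝ => 1 + (cexp (t * I) - 1) * (w g q₀ / cy q₀ ^ 2)) 0 :=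
    ContDiffAt.comp (0 : ℝ) (contDiffAt_csqrt h1) hin.contDiffAt
  exact contDiffAt_mk contDiffAt_const (contDiffAt_const.mul hsq)

/-! ### The curve at points with `y = 0`: `y` fixed, `x(t)^{2g+1} = e^{ic(t)}(x₀^{2g+1} + 1) − 1` -/

/-- The squashed parameter `c_δ(t) = δ t/√(1 + t²) ∈ (−δ, δ)` (so that the curve stays over the
flat region for all times). [folklore] -/
def cSq (δ t : ℝ) : ℝ := δ * (t * (√(1 + t ^ 2))⁻¹)

/-- `|c_δ(t)| < δ` for `δ > 0`. [folklore] -/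
theorem abs_cSq_lt {δ : ℝ} (hδ : 0 < δ) (t : ℝ) : |cSq δ t| < δ := by
  have hs : 0 < √(1 + t ^ 2) := Real.sqrt_pos.2 (by positivity)
  have ht : |t| < √(1 + t ^ 2) := by
    rw [← Real.sqrt_sq_eq_abs]
    exact Real.sqrt_lt_sqrt (sq_nonneg _) (by linarith)
  have h1 : |t * (√(1 + t ^ 2))⁻¹| < 1 := by
    rw [abs_mul, abs_inv, abs_of_pos hs, mul_inv_lt_iff₀ hs, one_mul]
    exact ht
  rw [cSq, abs_mul, abs_of_pos hδ]
  nlinarith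

/-- `c_δ(0) = 0`. [folklore] -/
@[simp] theorem cSq_zero (δ : ℝ) : cSq δ 0 = 0 := by simp [cSq]

/-- `c_δ` is smooth. [folklore] -/
theorem contDiff_cSq (δ : ℝ) : ContDiff ℝ ∞ (cSq δ) := by
  have h1 : ContDiff ℝ ∞ fun t : ℝ => √(1 + t ^ 2) :=
    (contDiff_const.add (contDiff_id.pow 2)).sqrt fun t => by positivity
  exact contDiff_const.mul (contDiff_id.mul (h1.inv fun t => (Real.sqrt_pos.2 (by positivity)).ne'))

/-- `c_δ'(0) = δ`. [folklore] -/
theorem hasDerivAt_cSq (δ : ℝ) : HasDerivAt (cSq δ) δ 0 := by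
  have h1 : HasDerivAt (fun t : ℝ => √(1 + t ^ 2)) 0 0 := by
    have h := ((hasDerivAt_pow 2 (0 : ℝ)).const_add 1).sqrt (by norm_num)
    simpa using h
  have h2 : HasDerivAt (fun t : ℝ => (√(1 + t ^ 2))⁻¹) 0 0 := by
    have h := h1.fun_inv (by norm_num)
    simpa using h
  have h3 : HasDerivAt (fun t : ℝ => t * (√(1 + t ^ 2))⁻¹) 1 0 := by
    have h := (hasDerivAt_id' (0 : ℝ)).fun_mul h2
    simpa using h
  have h4 := h3.const_mul δ
  rw [mul_one] at h4
  exact h4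

/-- The gap `δ = 2^{2g+1} − ‖x₀‖^{2g+1} > 0` for `‖x₀‖ < 2`. [folklore] -/
def gapB (g : ℕ) (X₀ : ℂ) : ℝ := 2 ^ (2 * g + 1) - ‖X₀‖ ^ (2 * g + 1)

/-- The gap is positive on the flat region. [folklore] -/
theorem gapB_pos (g : ℕ) {X₀ : ℂ} (hX : ‖X₀‖ < 2) : 0 < gapB g X₀ :=
  sub_pos.2 (pow_lt_pow_left₀ hX (norm_nonneg _) (by omega))

/-- The factor `A(t) = e^{ic} + (e^{ic} − 1)/x₀^{2g+1}` with `x(t)^{2g+1} = x₀^{2g+1} A(t)`.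
[folklore] -/
def facB (g : ℕ) (X₀ : ℂ) (t : ℝ) : ℂ :=
  cexp (cSq (gapB g X₀) t * I) + (cexp (cSq (gapB g X₀) t * I) - 1) * (X₀ ^ (2 * g + 1))⁻¹

/-- **Curve B** through `q₀ = (x₀, 0)`: `y = 0`, `x = x₀ A(t)^{1/(2g+1)}`, so that
`w = −x^{2g+1} − 1 = e^{ic(t)} w₀`; the squashing `c` keeps `‖x‖ ≤ 2` for all times. [folklore] -/
def curveB (g : ℕ) (X₀ : ℂ) (t : ℝ) : 𝔼 4 :=
  mk (X₀ * facB g X₀ t ^ (((2 * g + 1 : ℕ) : ℂ)⁻¹)) 0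

/-- `x(t)^{2g+1} = e^{ic}(x₀^{2g+1} + 1) − 1` along curve B. [folklore] -/
theorem cx_curveB_pow (g : ℕ) {X₀ : ℂ} (hX : X₀ ≠ 0) (t : ℝ) :
    cx (curveB g X₀ t) ^ (2 * g + 1) =
      cexp (cSq (gapB g X₀) t * I) * (X₀ ^ (2 * g + 1) + 1) - 1 := by
  rw [curveB, cx_mk, mul_pow, Complex.cpow_nat_inv_pow _ (by omega), facB]
  field_simp
  ring

/-- **`w = e^{ic(t)} (−x₀^{2g+1} − 1)` along curve B.** [folklore] -/
theorem w_curveB (g : ℕ) {X₀ : ℂ} (hX : X₀ ≠ 0) (t : ℝ) :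
    w g (curveB g X₀ t) = cexp (cSq (gapB g X₀) t * I) * (-(X₀ ^ (2 * g + 1)) - 1) := by
  rw [w, Phi, cx_curveB_pow g hX, curveB, cy_mk]
  ring

/-- `‖e^{ix} − 1‖ ≤ |x|`. [folklore] -/
theorem norm_cexp_mul_I_sub_one_le (x : ℝ) : ‖cexp (x * I) - 1‖ ≤ |x| := by
  rw [mul_comm, ← Real.norm_eq_abs]
  exact Real.norm_exp_I_mul_ofReal_sub_one_le

/-- **Curve B stays over the flat region**: `‖x(t)‖ ≤ 2`
(`‖x^{2g+1}‖ ≤ ‖x₀‖^{2g+1} + |c| ≤ 2^{2g+1}`). [folklore] -/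
theorem norm_cx_curveB_le (g : ℕ) {X₀ : ℂ} (hX : X₀ ≠ 0) (hX2 : ‖X₀‖ < 2) (t : ℝ) :
    ‖cx (curveB g X₀ t)‖ ≤ 2 := by
  have hpow : ‖cx (curveB g X₀ t)‖ ^ (2 * g + 1) ≤ 2 ^ (2 * g + 1) := by
    rw [← norm_pow, cx_curveB_pow g hX]
    have e : cexp (cSq (gapB g X₀) t * I) * (X₀ ^ (2 * g + 1) + 1) - 1 =
        cexp (cSq (gapB g X₀) t * I) * X₀ ^ (2 * g + 1) + (cexp (cSq (gapB g X₀) t * I) - 1) := by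
      ring
    rw [e]
    calc ‖cexp (cSq (gapB g X₀) t * I) * X₀ ^ (2 * g + 1) + (cexp (cSq (gapB g X₀) t * I) - 1)‖
        ≤ ‖cexp (cSq (gapB g X₀) t * I) * X₀ ^ (2 * g + 1)‖ +
            ‖cexp (cSq (gapB g X₀) t * I) - 1‖ := norm_add_le _ _
      _ ≤ ‖X₀‖ ^ (2 * g + 1) + |cSq (gapB g X₀) t| := by
          rw [norm_mul, Complex.norm_exp_ofReal_mul_I, one_mul, norm_pow]
          exact add_le_add le_rfl (norm_cexp_mul_I_sub_one_le _)
      _ ≤ ‖X₀‖ ^ (2 * g + 1) + gapB g X₀ :=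
          add_le_add le_rfl (abs_cSq_lt (gapB_pos g hX2) t).le
      _ = 2 ^ (2 * g + 1) := by rw [gapB]; ring
  exact le_of_pow_le_pow_left₀ (by omega) (by norm_num) hpow

/-- Curve B stays on the level `‖x₀^{2g+1} + 1‖²` (`= rho q₀` for `q₀ = (x₀, 0)` in the flat
region). [folklore] -/
theorem rho_curveB (g : ℕ) {X₀ : ℂ} (hX : X₀ ≠ 0) (hX2 : ‖X₀‖ < 2) (t : ℝ) :
    rho g (curveB g X₀ t) = ‖X₀ ^ (2 * g + 1) + 1‖ ^ 2 := by
  have hflat : ‖cx (curveB g X₀ t)‖ ^ 2 ≤ 4 := by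
    have := norm_cx_curveB_le g hX hX2 t
    nlinarith [norm_nonneg (cx (curveB g X₀ t))]
  rw [rho, w_curveB g hX, eta_of_le hflat, add_zero, norm_mul, Complex.norm_exp_ofReal_mul_I,
    one_mul, show -(X₀ ^ (2 * g + 1)) - 1 = -(X₀ ^ (2 * g + 1) + 1) by ring, norm_neg]

/-- Curve B starts at `(x₀, 0)`. [folklore] -/
theorem curveB_zero (g : ℕ) (X₀ : ℂ) : curveB g X₀ 0 = mk X₀ 0 := by
  rw [curveB, facB, cSq_zero, Complex.ofReal_zero, zero_mul, Complex.exp_zero, sub_self, zero_mul,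
    add_zero, Complex.one_cpow, mul_one]

/-- Curve B is smooth at `t = 0` (the root is taken near `1`). [folklore] -/
theorem contDiffAt_curveB (g : ℕ) (X₀ : ℂ) : ContDiffAt ℝ ∞ (curveB g X₀) 0 := by
  have hexp : ContDiff ℝ ∞ fun t : ℝ => cexp (cSq (gapB g X₀) t * I) :=
    Complex.contDiff_exp.comp
      ((Complex.ofRealCLM.contDiff.comp (contDiff_cSq _)).mul contDiff_const)
  have hfac : ContDiff ℝ ∞ (facB g X₀) := hexp.add ((hexp.sub contDiff_const).mul contDiff_const)
  have h1 : facB g X₀ 0 ∈ slitPlane := by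
    rw [facB, cSq_zero, Complex.ofReal_zero, zero_mul, Complex.exp_zero, sub_self, zero_mul,
      add_zero]
    exact Or.inl (by norm_num)
  have hroot : ContDiffAt ℝ ∞ (fun z : ℂ => z ^ (((2 * g + 1 : ℕ) : ℂ)⁻¹)) (facB g X₀ 0) :=
    (analyticAt_id.cpow analyticAt_const h1).restrictScalars.contDiffAt
  have hcomp : ContDiffAt ℝ ∞ ((fun z : ℂ => z ^ (((2 * g + 1 : ℕ) : ℂ)⁻¹)) ∘ facB g X₀) 0 :=
    ContDiffAt.comp (0 : ℝ) hroot hfac.contDiffAt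
  exact contDiffAt_mk (contDiffAt_const.mul hcomp) contDiffAt_const

/-! ### Assembly: `dθ ≠ 0` off the binding -/

/-- At a point of the level `rho = 1/4` with `y = 0`, `x ≠ 0` (since `rho (0, 0) = 1`).
[folklore] -/
theorem cx_ne_zero_of_cy_eq_zero (g : ℕ) {q : 𝔼 4} (hq : rho g q = 1 / 4) (hy : cy q = 0) :
    cx q ≠ 0 := by
  intro hx
  have : q = 0 := by rw [← mk_cx_cy q, hx, hy, mk_zero]
  rw [this, rho_zero] at hq
  norm_num at hq

/-- **`π = w/‖w‖` is a submersion on `∂ Base g ∖ B`**: its angular differential vanishes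
nowhere off the binding (curve A at points with `y ≠ 0`, curve B at points with `y = 0`).
[folklore] -/
theorem angularDeriv_proj_ne_zero (g : ℕ) {y₀ : (bBase g).carrier} (hw : w g (inclB g y₀) ≠ 0) :
    angularDeriv (proj g) y₀ ≠ 0 := by
  have hq : rho g (inclB g y₀) = 1 / 4 := rho_inclB g y₀
  by_cases hy : cy (inclB g y₀) = 0
  · -- curve B
    have hx0 : cx (inclB g y₀) ≠ 0 := cx_ne_zero_of_cy_eq_zero g hq hy
    have hx4 : ‖cx (inclB g y₀)‖ ^ 2 < 4 := norm_sq_cx_lt_four_of_cy_eq_zero g hq hy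
    have hx2 : ‖cx (inclB g y₀)‖ < 2 := by nlinarith [norm_nonneg (cx (inclB g y₀))]
    have hw0 : w g (inclB g y₀) = -(cx (inclB g y₀) ^ (2 * g + 1)) - 1 := by
      rw [show w g (inclB g y₀) = cy (inclB g y₀) ^ 2 - cx (inclB g y₀) ^ (2 * g + 1) - 1 from rfl,
        hy]
      ring
    have hlev : ∀ t, rho g (curveB g (cx (inclB g y₀)) t) = 1 / 4 := fun t => by
      rw [rho_curveB g hx0 hx2, ← hq, rho, hw0, eta_of_le hx4.le, add_zero,
        show -(cx (inclB g y₀) ^ (2 * g + 1)) - 1 = -(cx (inclB g y₀) ^ (2 * g + 1) + 1) by ring,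
        norm_neg]
    set γ : ℝ → (bBase g).carrier := fun t => bPt g (curveB g (cx (inclB g y₀)) t) (hlev t) with hγ
    have h0 : γ 0 = y₀ := inclB_injective g (by
      rw [hγ]; show curveB g (cx (inclB g y₀)) 0 = inclB g y₀
      rw [curveB_zero, ← hy, mk_cx_cy])
    rw [← h0]
    refine angularDeriv_proj_ne_zero_of_curve g γ (by rw [h0]; exact hw)
      (contMDiffAt_bPt g hlev (contDiffAt_curveB g _).contMDiffAt)
      (hasDerivAt_cSq (gapB g (cx (inclB g y₀)))) (cSq_zero _) (gapB_pos g hx2).ne' fun t => ?_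
    rw [h0, hw0]
    exact w_curveB g hx0 t
  · -- curve A
    have hlev : ∀ t, rho g (curveA g (inclB g y₀) t) = 1 / 4 := fun t => by rw [rho_curveA g hy, hq]
    set γ : ℝ → (bBase g).carrier := fun t => bPt g (curveA g (inclB g y₀) t) (hlev t) with hγ
    have h0 : γ 0 = y₀ := inclB_injective g (by
      rw [hγ]; show curveA g (inclB g y₀) 0 = inclB g y₀
      exact curveA_zero g _)
    rw [← h0]
    refine angularDeriv_proj_ne_zero_of_curve g γ (by rw [h0]; exact hw)
      (contMDiffAt_bPt g hlev (contDiffAt_curveA g _).contMDiffAt) (hasDerivAt_id (0 : ℝ)) rfl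
      one_ne_zero fun t => ?_
    rw [h0]
    exact w_curveA g hy t

end Submersion

/-! ## §16 The boundary open book of the standard base -/

section OpenBookDef

open Literature.Geometry.Symplectic

/-- **THE BOUNDARY OPEN BOOK OF THE STANDARD LEFSCHETZ BASE** `∂ Base g` (on paper
`∂(F_{g,1} × D²) = (F_{g,1} × S¹) ∪ (∂F_{g,1} × D²)`, the open book with page `F_{g,1}`, binding
`∂F_{g,1}` and trivial monodromy; Etnyre–Fuller 2006, §2; Etnyre 2006, §2): ONE binding
component `B = {w = 0} ∩ ∂ Base g = {y² = x^{2g+1} + 1, ‖x‖² = etaInv (1/4)}` (a connected double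
cover of the circle `‖x‖ = r₀`), with the tube `LefschetzBase.tube g` in the normal form
`w ∘ tube (p, v) = v/(4√(1 + ‖v‖²))`, and the fibration `π = w/‖w‖` — the argument of
`w = y² − x^{2g+1} − 1` — whose fibres over the flat part `‖x‖² < 4` of the boundary are the base
pages `LefschetzBase.page g c = {w = c/2}` (`mem_page_boundaryOpenBook_of_mem_page`).  Everything
in the structure is proved: the tube is a smooth open embedding onto `{‖w‖ < 1/4}`, `π` is smooth
with nowhere-vanishing angular differential off `B`. [cite: EtnyreFuller2006, §2] -/
def boundaryOpenBook (g : ℕ) : OpenBook (bBase g).carrier where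
  k := 1
  k_pos := one_pos
  tube := fun _ => tube g
  proj := proj g
  isSmoothEmbedding_tube := fun _ => isSmoothEmbedding_tube g
  isOpen_range_tube := fun _ => isOpen_range_tube g
  eq_zero_of_tube_eq := fun _ _ x x' v h => tube_eq_core_imp g x x' v h
  proj_tube := fun _ x _ hv => proj_tube g x hv
  contMDiffOn_proj := by
    rw [tubesBinding_tube]
    exact contMDiffOn_proj g
  angularDeriv_ne_zero := fun y hy => by
    rw [tubesBinding_tube] at hy
    exact angularDeriv_proj_ne_zero g hy

/-- The boundary open book has one binding tube (definitional). [folklore] -/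
@[simp] theorem boundaryOpenBook_k (g : ℕ) : (boundaryOpenBook g).k = 1 := rfl

/-- Its tube is `LefschetzBase.tube g` (definitional). [folklore] -/
@[simp] theorem boundaryOpenBook_tube (g : ℕ) (i : Fin (boundaryOpenBook g).k) :
    (boundaryOpenBook g).tube i = tube g := rfl

/-- Its fibration is `LefschetzBase.proj g = w/‖w‖` (definitional). [folklore] -/
@[simp] theorem boundaryOpenBook_proj (g : ℕ) : (boundaryOpenBook g).proj = proj g := rfl

/-- **The binding of the boundary open book is `{w = 0} ∩ ∂ Base g`.** [folklore] -/
theorem binding_boundaryOpenBook (g : ℕ) :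
    (boundaryOpenBook g).binding = {y | w g (inclB g y) = 0} :=
  tubesBinding_tube g

/-- Membership in the binding: `y ∈ B ↔ w(y) = 0`. [folklore] -/
theorem mem_binding_boundaryOpenBook_iff (g : ℕ) (y : (bBase g).carrier) :
    y ∈ (boundaryOpenBook g).binding ↔ w g ((bBase g).incl y).1 = 0 := by
  rw [binding_boundaryOpenBook]
  rfl

/-- **The fibration of the boundary open book is the argument of `w`**: off the binding,
`π(y) = w/‖w‖ ∈ 𝕊¹ ⊂ ℝ²`. [folklore] -/
theorem proj_boundaryOpenBook (g : ℕ) (y : (bBase g).carrier) (hy : w g ((bBase g).incl y).1 ≠ 0) :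
    (((boundaryOpenBook g).proj y : 𝕊¹) : 𝔼 2) =
      ‖w g ((bBase g).incl y).1‖⁻¹ • vec2 (w g ((bBase g).incl y).1) :=
  coe_proj g hy

/-- The normal form of `w` in the tube of the boundary open book: `w (tube (p, v)) = w̃ v`,
a positive multiple of `v`. [folklore] -/
theorem w_boundaryOpenBook_tube (g : ℕ) (i : Fin (boundaryOpenBook g).k) (p : 𝕊¹) (v : 𝔼 2) :
    w g ((bBase g).incl ((boundaryOpenBook g).tube i (p, v))).1 = (wsc v : ℂ) * toC v :=
  w_tube g (p, v)

/-- The image of each tube of the boundary open book is the solid torus `{‖w‖ < 1/4}`.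
[folklore] -/
theorem range_boundaryOpenBook_tube (g : ℕ) (i : Fin (boundaryOpenBook g).k) :
    range ((boundaryOpenBook g).tube i) = {y | ‖w g ((bBase g).incl y).1‖ < 1 / 4} :=
  range_tube g

/-- `vec2 (c/2) = ½ • vec2 c`. [folklore] -/
theorem vec2_half (c : ℂ) : vec2 (c / 2) = (2⁻¹ : ℝ) • vec2 c := by
  rw [← vec2_ofReal_mul]; congr 1; push_cast; ring

/-- **Base pages are pages of the boundary open book**: a boundary point lying on
`page g c = {‖x‖² < 4, w = c/2}` (`‖c‖ = 1`) lies on the open-book page over `c ∈ 𝕊¹`. [folklore] -/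
theorem mem_page_boundaryOpenBook_of_mem_page (g : ℕ) {c : ℂ} (hc : ‖c‖ = 1) (y : (bBase g).carrier)
    (h : (bBase g).incl y ∈ page g c) :
    y ∈ (boundaryOpenBook g).page ⟨vec2 c, vec2_mem_sphere hc⟩ := by
  obtain ⟨-, hw⟩ := h
  have hc0 : c ≠ 0 := fun h0 => by rw [h0, norm_zero] at hc; exact zero_ne_one hc
  have hw' : w g (inclB g y) = c / 2 := hw
  have hw0 : w g (inclB g y) ≠ 0 := by rw [hw']; exact div_ne_zero hc0 two_ne_zero
  refine ⟨fun hb => hw0 ((mem_binding_boundaryOpenBook_iff g y).1 hb), Subtype.ext ?_⟩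
  show ((proj g y : 𝕊¹) : 𝔼 2) = vec2 c
  rw [coe_proj g hw0, hw', vec2_half, norm_div, hc, smul_smul]
  norm_num

/-- **Conversely, on the flat part the open-book pages are the base pages**: a boundary point
with `‖x‖² < 4` on the open-book page over `c` has `w = c/2` (there `‖w‖ = 1/2`). [folklore] -/
theorem mem_page_of_mem_page_boundaryOpenBook (g : ℕ) {c : ℂ} (hc : ‖c‖ = 1) (y : (bBase g).carrier)
    (hx : ‖cx ((bBase g).incl y).1‖ ^ 2 < 4)
    (h : y ∈ (boundaryOpenBook g).page ⟨vec2 c, vec2_mem_sphere hc⟩) :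
    (bBase g).incl y ∈ page g c := by
  obtain ⟨hb, hproj⟩ := h
  have hw0 : w g (inclB g y) ≠ 0 := fun h0 => hb ((mem_binding_boundaryOpenBook_iff g y).2 h0)
  have hrho : rho g (inclB g y) = 1 / 4 := rho_inclB g y
  have hx' : ‖cx (inclB g y)‖ ^ 2 < 4 := hx
  have hnorm : ‖w g (inclB g y)‖ = 1 / 2 := by
    rw [rho, eta_of_le hx'.le, add_zero] at hrho
    have h := norm_nonneg (w g (inclB g y))
    nlinarith
  have hcoe : ((proj g y : 𝕊¹) : 𝔼 2) = vec2 c := congrArg Subtype.val hproj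
  rw [coe_proj g hw0, hnorm] at hcoe
  have hvec : vec2 (w g (inclB g y)) = vec2 (c / 2) := by
    rw [vec2_half, ← hcoe, smul_smul]; norm_num
  exact ⟨hx', vec2_injective hvec⟩

end OpenBookDef

end LefschetzBase

end Literature.Topology.FourManifolds
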